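import Literature.NumberTheory.LFunctions.Polymath15HeatRSExpansion
import Literature.NumberTheory.LFunctions.Polymath15ErrorMajorants
import Literature.NumberTheory.LFunctions.RiemannSiegelLehmerBounds
import Mathlib.Analysis.SpecialFunctions.Gamma.BohrMollerup
import HarnessLib

/-!
# Polymath 15, Proposition 6.3 (the estimate for `R_{t,N}`), with corrected constants

Topic `Literature/NumberTheory/LFunctions` — companion of `Polymath15EffectiveApproximation.lean`
(objects of Thm. 1.3 and the named fact `Polymath15.effective_approximation`),
`Polymath15RtnEstimate.lean` (Prop. 6.1, E1), `Polymath15ErrorMajorants.lean` (Prop. 6.6 (iv)–(vi),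
E4a), `Polymath15HeatRSExpansion.lean` (§4 eq. (htz-expand), E0) and `RiemannSiegelLehmerBounds.lean`
(the named fact `arias_lehmer_rs_bound` = Arias de Reyna 2011, Thms. 3.1/4.1/4.2, the source's
Prop. 6.2; E2). This file is item **E3** of the typed decomposition of the printed proof of
Polymath 15, Thm. 1.3: the bound for the heat-flowed Riemann–Siegel remainder

  `|R_{t,N}(σ + iT)| ≤ e^{tπ²/64} |M₀(iT')| (1/2 + ε̃♯(σ + iT))`, `T' = T + πt/8`, `N = ⌊√(T'/2π)⌋`,

for `0 < t ≤ 1/2`, `0 ≤ σ ≤ 1`, `T ≥ 100`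
(`Literature.NumberTheory.LFunctions.Polymath15.RtN_bound_sharp`), CONDITIONAL on the named fact
`arias_lehmer_rs_bound` (taken as a hypothesis; no new named fact is introduced here).

## The correction

The source's Prop. 6.2 quotes Arias de Reyna's bound `|C_k(p,σ)| ≤ 2^{1/2−σ} Γ(k/2)/(2π((3−2log 2)π)^{k/2})`
(`σ ≤ 0`; Arias de Reyna 2011, Thm. 4.1, eq. (4.3)) with an extra factor `1/(2π)`, and the proof of
Prop. 6.3 uses the value `0.036` for `2^{1/2}/(2π) · 1/(2π)` where the source's source gives
`2^{1/2}/(2π) = 0.2251`. Consequently the printed constant `0.397 = 0.366 + 0.031` of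
`ε̃ = (0.397·9^σ/(a−0.865) + 5/(3(T−6))) e^{3.49/(T−4)}` does not follow from the cited input (with
the correct constant the `k = 1` terms alone exceed it for large `T` at `σ = 0`, `t = 1/2`). We
therefore prove Prop. 6.3 with the majorant `ε̃♯ = epsSharp t σ T` that the printed argument actually
yields from `arias_lehmer_rs_bound`, keeping the printed architecture:

* shift of the line of integration by `πi√t/8` (eq. (RTN-def) with `β_N = πi/4`; modulus form,
  `norm_Rt_le_integral`, via the Gaussian contour shift `integral_gaussian_shift` of E1);
* pointwise on the line `Im s = T'`: Stirling with the `1/(12z)` term and Binet remainder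
  (`GammaStirling.exists_Gamma_eq_exp_stirlingExp`) and the second-order Taylor expansion of
  `log M₀` (`norm_logM₀_taylor_le`), giving `|(1/8)(s(s−1)/2)π^{−s/2}Γ(s/2)| ≤ |M₀(iT')| a^{u}
  e^{u²/(4(T'−3)) + ((7/6)|u|+0.33)/T'²}` at `s = u + iT'` (`norm_xiFactor_line_le`; only real parts
  enter, so the source's `6|u|/(4(T−3))` is not needed), times Prop. 6.2 in modulus form
  (`norm_rsLineIntegral_le_ariasW`, `norm_R0_line_le`);
* the regimes of the source: `u ≥ 0` with `K = 1` (`ariasW_sum_le_pos`: the families `9^u/a` and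
  `2^{3u/2}/a²`), `u < 0` with `K` large — here `K = 6` on `−4 ≤ u < 0` (`ariasW_sum_le_neg`, the
  family `2^{−u}(0.1775/a + 0.0445/a² + 0.0176/a³ + 0.07/a⁴)`) and `K = ⌈−u⌉ + 2` on the far tail
  `u < −4` (`ariasW_sum_le_far`, negligible: `10⁻⁷/a`, cf. the source's `δ₃ ≤ 2·10⁻³⁰/a^{14}`);
* Gaussian integration with eq. (gaussian) (`integral_gauss_family`); the `2^{−u}` family is
  integrated over `u < 0` only, by the elementary half-line bound `integral_gauss_half_le` (factor
  `τ♯ = tauS t σ`), where the source integrates all families over the whole line.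

Numerically (not part of the proofs): with `ε̃♯` in place of `ε̃`, the majorant `errC0` of Thm. 1.3
still dominates `e_{C,0}` in the region (1.6) with a relative margin ≥ 5 % in the exponent; this is
item E4a♯, proved elsewhere.

## Contents

* `integral_exp_quad`, `integral_indicator_Iio_exp_le` — real Gaussian integrals (full/half line);
* `ariasW`, `ariasRS`, `norm_rsLineIntegral_le_ariasW` — Prop. 6.2 in modulus form from E2;
  `ariasW_sum_le_pos`, `ariasW_sum_le_neg`, `ariasW_sum_le_far` — the three regimes;
* `exists_xiFactor_eq_M₀_mul_exp'`, `norm_xiFactor_line_le`, `norm_R0_line_le` — pointwise bounds;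
* `kapS`, `gaussF`, `tauS`, `epsSharp` — the corrected majorant; `q_le`, `integral_gauss_family`,
  `integral_gauss_half_le`, `far_pointwise`, `far_integral_le`;
* `exists_norm_R0_strip_le`, `norm_Rt_le_integral` — the contour shift;
* `rtMajorant`, `pointwise_le_rtMajorant`, `integral_rtMajorant_le`, `RtN_bound_sharp` — Prop. 6.3♯.

## References

* D. H. J. Polymath, *Effective approximation of heat flow evolution of the Riemann ξ function, and
  a new upper bound for the de Bruijn–Newman constant*, Res. Math. Sci. 6 (2019), Paper 31,
  arXiv:1904.12438: §6.2, Prop. 6.2, Prop. 6.3 and its proof, eq. (gaussian). [Polymath2019]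
* J. Arias de Reyna, *High precision computation of Riemann's zeta function by the Riemann–Siegel
  formula, I*, Math. Comp. 80 (2011), 995–1009: Thm. 4.1 (eqs. (4.2)–(4.3)), Thm. 4.2.
  [AriasDeReyna2011]
-/

noncomputable section

open Complex MeasureTheory Set Filter Topology

open scoped Real

namespace Literature.NumberTheory.LFunctions

namespace Polymath15

open SiegelIntegral

/-! ## Real Gaussian integrals with a quadratic exponent, full line and half line -/

section Gauss

/-- `∫ e^{−A v² + B v + C} dv = √(π/A) e^{B²/(4A) + C}` (`A > 0`): the Gaussian identity (gaussian) of
the source. [cite: Polymath2019, §6, eq. (gaussian)] -/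
theorem integral_exp_quad {A : ℝ} (hA : 0 < A) (B C : ℝ) :
    ∫ v : ℝ, Real.exp (-A * v ^ 2 + B * v + C) =
      Real.sqrt (π / A) * Real.exp (B ^ 2 / (4 * A) + C) := by
  have h := integral_add_right_eq_self (μ := volume)
    (fun v : ℝ ↦ Real.exp (-A * v ^ 2 + B * v + C)) (B / (2 * A))
  rw [← h]
  have : ∀ v : ℝ, Real.exp (-A * (v + B / (2 * A)) ^ 2 + B * (v + B / (2 * A)) + C)
      = Real.exp (B ^ 2 / (4 * A) + C) * Real.exp (-A * v ^ 2) := fun v ↦ by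
    rw [← Real.exp_add]
    congr 1
    field_simp
    ring
  simp_rw [this]
  rw [integral_const_mul, integral_gaussian, mul_comm]

/-- `e^{−A v² + B v + C}` is integrable (`A > 0`). [cite: Polymath2019, §6, eq. (gaussian)] -/
theorem integrable_exp_quad {A : ℝ} (hA : 0 < A) (B C : ℝ) :
    Integrable fun v : ℝ ↦ Real.exp (-A * v ^ 2 + B * v + C) := by
  have : ∀ v : ℝ, Real.exp (-A * v ^ 2 + B * v + C)
      = Real.exp (B ^ 2 / (4 * A) + C) * Real.exp (-A * (v - B / (2 * A)) ^ 2) := fun v ↦ by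
    rw [← Real.exp_add]
    congr 1
    field_simp
    ring
  simp_rw [this]
  refine Integrable.const_mul ?_ _
  have h := (integrable_exp_neg_mul_sq hA).comp_sub_right (B / (2 * A))
  exact h

/-- The half Gaussian integral `∫_{v<0} e^{−A v²} dv = √(π/A)/2` (used for the tail integrals of
the source's `δ₃`). [cite: Polymath2019, Prop. 6.3, proof, estimate of δ₃] -/
theorem integral_Iio_exp_neg_mul_sq (A : ℝ) :
    ∫ v in Iio (0 : ℝ), Real.exp (-A * v ^ 2) = Real.sqrt (π / A) / 2 := by
  rw [← integral_Iic_eq_integral_Iio]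
  have h := integral_comp_neg_Iic 0 (fun v : ℝ ↦ Real.exp (-A * v ^ 2))
  simp only [neg_sq, neg_zero] at h
  rw [h, integral_gaussian_Ioi]

/-- **Half-line Gaussian bound**: for `v₀ ≤ μ`,
`∫ 1_{v < v₀} e^{−A (v−μ)²} dv ≤ (√(π/A)/2) e^{−A (v₀−μ)²}` (since `(v−μ)² ≥ (v−v₀)² + (v₀−μ)²`
for `v ≤ v₀ ≤ μ`); the elementary tail bound behind the source's `δ₃` estimate.
[cite: Polymath2019, Prop. 6.3, proof, estimate of δ₃] -/
theorem integral_indicator_Iio_exp_le {A μ v₀ : ℝ} (hA : 0 < A) (hv : v₀ ≤ μ) :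
    ∫ v : ℝ, (Iio v₀).indicator (fun v ↦ Real.exp (-A * (v - μ) ^ 2)) v ≤
      Real.sqrt (π / A) / 2 * Real.exp (-A * (v₀ - μ) ^ 2) := by
  have hpt : ∀ v : ℝ, (Iio v₀).indicator (fun v ↦ Real.exp (-A * (v - μ) ^ 2)) v ≤
      Real.exp (-A * (v₀ - μ) ^ 2) *
        (Iio v₀).indicator (fun v ↦ Real.exp (-A * (v - v₀) ^ 2)) v := fun v ↦ by
    by_cases hv' : v ∈ Iio v₀
    · rw [indicator_of_mem hv', indicator_of_mem hv', ← Real.exp_add]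
      refine Real.exp_le_exp.2 ?_
      have h1 : (v - v₀) * (v₀ - μ) ≥ 0 := mul_nonneg_of_nonpos_of_nonpos
        (by linarith [mem_Iio.1 hv']) (by linarith)
      nlinarith
    · rw [indicator_of_notMem hv', indicator_of_notMem hv', mul_zero]
  have hint : Integrable fun v : ℝ ↦ Real.exp (-A * (v₀ - μ) ^ 2) *
      (Iio v₀).indicator (fun v ↦ Real.exp (-A * (v - v₀) ^ 2)) v :=
    (((integrable_exp_neg_mul_sq hA).comp_sub_right v₀).indicator measurableSet_Iio).const_mul _
  refine (integral_mono_of_nonneg (Eventually.of_forall fun v ↦ ?_) hint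
    (Eventually.of_forall hpt)).trans (le_of_eq ?_)
  · exact indicator_nonneg (fun _ _ ↦ (Real.exp_pos _).le) _
  · rw [integral_const_mul, integral_indicator measurableSet_Iio, mul_comm]
    congr 1
    have h := integral_add_right_eq_self (μ := volume)
      (fun v : ℝ ↦ (Iio v₀).indicator (fun v ↦ Real.exp (-A * (v - v₀) ^ 2)) v) v₀
    rw [← integral_indicator measurableSet_Iio, ← h]
    have : ∀ v : ℝ, (Iio v₀).indicator (fun v ↦ Real.exp (-A * (v - v₀) ^ 2)) (v + v₀)
        = (Iio (0 : ℝ)).indicator (fun v ↦ Real.exp (-A * v ^ 2)) v := fun v ↦ by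
      by_cases hv' : v < 0
      · rw [indicator_of_mem (show v + v₀ ∈ Iio v₀ by simp [hv']),
          indicator_of_mem (show v ∈ Iio 0 from hv')]
        simp
      · rw [indicator_of_notMem (show v + v₀ ∉ Iio v₀ by simp [not_lt.1 hv']),
          indicator_of_notMem (show v ∉ Iio 0 from hv')]
    simp_rw [this]
    rw [integral_indicator measurableSet_Iio, integral_Iio_exp_neg_mul_sq A]

/-- The full-line bound `∫ 1_{v<v₀} e^{−A(v−μ)²} dv ≤ √(π/A)`.
[cite: Polymath2019, §6, eq. (gaussian)] -/
theorem integral_indicator_Iio_exp_le' {A : ℝ} (hA : 0 < A) (μ v₀ : ℝ) :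
    ∫ v : ℝ, (Iio v₀).indicator (fun v ↦ Real.exp (-A * (v - μ) ^ 2)) v ≤ Real.sqrt (π / A) := by
  have hint : Integrable fun v : ℝ ↦ Real.exp (-A * (v - μ) ^ 2) :=
    (integrable_exp_neg_mul_sq hA).comp_sub_right μ
  refine (integral_mono_of_nonneg (Eventually.of_forall fun v ↦ ?_) hint
    (Eventually.of_forall fun v ↦ ?_)).trans (le_of_eq ?_)
  · exact indicator_nonneg (fun _ _ ↦ (Real.exp_pos _).le) _
  · exact indicator_le_self' (fun _ _ ↦ (Real.exp_pos _).le) v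
  · have h := integral_sub_right_eq_self (μ := volume) (fun v : ℝ ↦ Real.exp (-A * v ^ 2)) μ
    rw [h, integral_gaussian]

end Gauss


/-! ## The Riemann–Siegel remainder from Arias de Reyna's bounds (Prop. 6.2, corrected) -/

section Arias

/-- The termwise majorant of `|C_k| a^{-k}` in Lehmer's form: `1/2` for `k = 0` (eq. (cop)) and
`c(σ) Γ(k/2)/(b(σ) a)^k` for `k ≥ 1` (Arias de Reyna, Thm. 4.1).
[cite: Polymath2019, Prop. 6.2 and eq. (cop)] -/
def ariasW (σ a : ℝ) (k : ℕ) : ℝ :=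
  if k = 0 then 1 / 2 else ariasC σ * Real.Gamma ((k : ℝ) / 2) / (ariasB σ * a) ^ k

/-- The remainder majorant `c₁(σ) Γ((K+1)/2)/(a/1.1)^{K+1}` of Arias de Reyna, Thm. 4.2.
[cite: Polymath2019, Prop. 6.2] -/
def ariasRS (σ a : ℝ) (K : ℕ) : ℝ :=
  ariasC1 σ * Real.Gamma (((K : ℝ) + 1) / 2) / (a / 1.1) ^ (K + 1)

/-- **Prop. 6.2 in modulus form**: for `s = σ + iT'`, `T' > 0`, `a = √(T'/2π)`, `N = ⌊a⌋` and an
admissible `K` (`K ≥ 1`, `σ ≥ 0` or `K + σ ≥ 2`),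
`|∫_{N↙N+1}| ≤ a^{−σ} (Σ_{k=0}^{K} w_k + c₁ Γ((K+1)/2)/(a/1.1)^{K+1})`, `w_0 = 1/2`,
`w_k = c Γ(k/2)/(b a)^k` — from the named fact `arias_lehmer_rs_bound` (Arias de Reyna 2011,
Thms. 3.1, 4.1, 4.2 and `|C₀| ≤ 1/2`). [cite: Polymath2019, Prop. 6.2 and eq. (cop)] -/
theorem norm_rsLineIntegral_le_ariasW (h : arias_lehmer_rs_bound) {σ T' : ℝ} (hT' : 0 < T')
    {K : ℕ} (hK : 1 ≤ K) (hσK : 0 ≤ σ ∨ (2 : ℝ) ≤ K + σ) :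
    ‖rsLineIntegral (⌊Real.sqrt (T' / (2 * π))⌋₊ + 1 / 2) ((σ : ℂ) + T' * I)‖ ≤
      Real.sqrt (T' / (2 * π)) ^ (-σ) *
        (∑ k ∈ Finset.range (K + 1), ariasW σ (Real.sqrt (T' / (2 * π))) k +
          ariasRS σ (Real.sqrt (T' / (2 * π))) K) := by
  obtain ⟨C, hC0, hCk, hR⟩ := h σ T' K hT' hK hσK
  set a : ℝ := Real.sqrt (T' / (2 * π)) with ha
  have ha0 : 0 < a := Real.sqrt_pos.2 (by positivity)
  set J := rsLineIntegral (⌊a⌋₊ + 1 / 2) ((σ : ℂ) + T' * I) with hJ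
  set M := (-1 : ℂ) ^ (⌊a⌋₊ + 1) * ariasU T' * ((a : ℂ) ^ (-(σ : ℂ))) *
    ∑ k ∈ Finset.range (K + 1), C k / ((a : ℂ)) ^ k with hM
  have hterm : ∀ k ∈ Finset.range (K + 1), ‖C k‖ / a ^ k ≤ ariasW σ a k := by
    intro k hk
    rcases Nat.eq_zero_or_pos k with h0 | hpos
    · subst h0
      simpa [ariasW] using hC0
    · rw [ariasW, if_neg (by omega), mul_pow, ← div_div]
      exact div_le_div_of_nonneg_right (hCk k hpos (by simpa [Finset.mem_range, Nat.lt_succ_iff] using hk))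
        (pow_nonneg ha0.le _)
  have hMn : ‖M‖ ≤ a ^ (-σ) * ∑ k ∈ Finset.range (K + 1), ariasW σ a k := by
    rw [hM, norm_mul, norm_mul, norm_mul, norm_pow, norm_neg, norm_one, one_pow, one_mul,
      norm_ariasU, one_mul]
    have h1 : ‖((a : ℂ) ^ (-(σ : ℂ)))‖ = a ^ (-σ) := by
      rw [Complex.norm_cpow_eq_rpow_re_of_pos ha0]
      simp
    rw [h1]
    refine mul_le_mul_of_nonneg_left ((norm_sum_le _ _).trans (Finset.sum_le_sum fun k hk ↦ ?_))
      (Real.rpow_nonneg ha0.le _)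
    rw [norm_div, norm_pow, Complex.norm_of_nonneg ha0.le]
    exact hterm k hk
  have hRS : a ^ (-σ) * ariasC1 σ * Real.Gamma (((K : ℝ) + 1) / 2) / (a / 1.1) ^ (K + 1)
      = a ^ (-σ) * ariasRS σ a K := by
    rw [ariasRS]; ring
  calc ‖J‖ = ‖(J - M) + M‖ := by rw [sub_add_cancel]
    _ ≤ ‖J - M‖ + ‖M‖ := norm_add_le _ _
    _ ≤ a ^ (-σ) * ariasRS σ a K + a ^ (-σ) * ∑ k ∈ Finset.range (K + 1), ariasW σ a k := by
        rw [← hRS]; exact add_le_add hR hMn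
    _ = _ := by ring

/-- `c(u) ≤ 9^u/(√2 π)` for `u ≥ 0` (with equality for `u > 0`; `c(0) = 1/(√2 π)`).
[cite: AriasDeReyna2011, Thm. 4.1, eq. (4.2)] -/
theorem ariasC_le_of_nonneg {u : ℝ} (hu : 0 ≤ u) :
    ariasC u ≤ (9 : ℝ) ^ u / (Real.sqrt 2 * π) := by
  rcases hu.lt_or_eq with h | h
  · rw [ariasC_of_pos h]
  · rw [← h, ariasC_of_nonpos le_rfl]; simp

/-- `b(u) ≥ 2` for all `u` (`√((3 − 2 log 2)π) = 2.25… ≥ 2`).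
[cite: AriasDeReyna2011, Thm. 4.1, eq. (4.2)] -/
theorem two_le_ariasB (u : ℝ) : 2 ≤ ariasB u := by
  unfold ariasB
  split_ifs
  · exact le_rfl
  · refine Real.le_sqrt_of_sq_le ?_
    have := Real.log_two_lt_d9
    have := Real.pi_gt_three
    nlinarith

/-- `ariasB u = √((3 − 2 log 2) π)` for `u ≤ 0`. [cite: AriasDeReyna2011, Thm. 4.1, eq. (4.2)] -/
theorem ariasB_of_nonpos {u : ℝ} (hu : u ≤ 0) :
    ariasB u = Real.sqrt ((3 - 2 * Real.log 2) * π) := by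
  simp [ariasB, not_lt.2 hu]

/-- `2.25 ≤ √((3 − 2 log 2) π)` (`= 2.2516…`, Arias de Reyna's `b(σ)` for `σ ≤ 0`).
[cite: AriasDeReyna2011, Thm. 4.1, eqs. (4.2)–(4.3)] -/
theorem ariasB_neg_ge : (2.25 : ℝ) ≤ Real.sqrt ((3 - 2 * Real.log 2) * π) := by
  refine Real.le_sqrt_of_sq_le ?_
  have := Real.log_two_lt_d9
  have := Real.pi_gt_d2
  nlinarith

/-- `c₁(u) ≤ 1/2` for `u < 0`. [cite: AriasDeReyna2011, Thm. 4.2, eq. (4.8)] -/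
theorem ariasC1_le_half_of_neg {u : ℝ} (hu : u < 0) : ariasC1 u ≤ 1 / 2 := by
  rw [ariasC1, if_neg (not_le.2 hu)]
  have : (9 / 10 : ℝ) ^ ⌈-u⌉₊ ≤ 1 := pow_le_one₀ (by norm_num) (by norm_num)
  linarith

/-- The values `Γ(1/2) = √π`, `Γ(3/2) = √π/2`, `Γ(5/2) = 3√π/4`, `Γ(7/2) = 15√π/8`. [folklore] -/
private theorem Real_Gamma_halves :
    Real.Gamma (1 / 2) = Real.sqrt π ∧ Real.Gamma (3 / 2) = Real.sqrt π / 2 ∧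
      Real.Gamma (5 / 2) = 3 * Real.sqrt π / 4 ∧ Real.Gamma (7 / 2) = 15 * Real.sqrt π / 8 := by
  have h1 : Real.Gamma (1 / 2) = Real.sqrt π := Real.Gamma_one_half_eq
  have h3 : Real.Gamma (3 / 2) = Real.sqrt π / 2 := by
    rw [show (3 / 2 : ℝ) = 1 / 2 + 1 by norm_num, Real.Gamma_add_one (by norm_num), h1]; ring
  have h5 : Real.Gamma (5 / 2) = 3 * Real.sqrt π / 4 := by
    rw [show (5 / 2 : ℝ) = 3 / 2 + 1 by norm_num, Real.Gamma_add_one (by norm_num), h3]; ring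
  have h7 : Real.Gamma (7 / 2) = 15 * Real.sqrt π / 8 := by
    rw [show (7 / 2 : ℝ) = 5 / 2 + 1 by norm_num, Real.Gamma_add_one (by norm_num), h5]; ring
  exact ⟨h1, h3, h5, h7⟩

/-- `Γ(3) = 2`. [folklore] -/
private theorem Real_Gamma_three : Real.Gamma 3 = 2 := by
  have h := Real.Gamma_nat_eq_factorial 2
  rw [show ((2 : ℕ) : ℝ) + 1 = 3 by norm_num] at h
  rw [h]; norm_num [Nat.factorial]

/-- **The regime `u ≥ 0`, `K = 1`**:
`Σ_{k≤1} w_k + RS_1 ≤ 1/2 + (√π/(2√2π)) 9^u/a + (1.21/7) 2^{3u/2}/a²`.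
[cite: Polymath2019, Prop. 6.3, proof, eq. (u0)] -/
theorem ariasW_sum_le_pos {u a : ℝ} (hu : 0 ≤ u) (ha : 0 < a) :
    ∑ k ∈ Finset.range 2, ariasW u a k + ariasRS u a 1 ≤
      1 / 2 + Real.sqrt π / (2 * (Real.sqrt 2 * π)) * (9 : ℝ) ^ u / a +
        1.21 / 7 * (2 : ℝ) ^ (3 * u / 2) / a ^ 2 := by
  have hc := ariasC_le_of_nonneg hu
  have hc0 := (ariasC_pos u).le
  have hb := two_le_ariasB u
  have hb0 := ariasB_pos u
  obtain ⟨hG1, -, -, -⟩ := Real_Gamma_halves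
  simp only [Finset.sum_range_succ, Finset.sum_range_zero, ariasW, ariasRS, zero_add,
    if_true, Nat.cast_one, one_ne_zero, if_false, pow_one, ariasC1_of_nonneg hu]
  rw [show ((1 : ℝ) + 1) / 2 = 1 by norm_num, Real.Gamma_one, hG1]
  have h1 : ariasC u * Real.sqrt π / (ariasB u * a) ≤
      Real.sqrt π / (2 * (Real.sqrt 2 * π)) * (9 : ℝ) ^ u / a := by
    calc ariasC u * Real.sqrt π / (ariasB u * a)
        ≤ (9 : ℝ) ^ u / (Real.sqrt 2 * π) * Real.sqrt π / (2 * a) := by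
          rw [div_le_div_iff₀ (by positivity) (by positivity)]
          have : 0 ≤ Real.sqrt π := Real.sqrt_nonneg _
          have h9 : 0 ≤ (9 : ℝ) ^ u / (Real.sqrt 2 * π) * Real.sqrt π := by positivity
          calc ariasC u * Real.sqrt π * (2 * a) ≤ (9 : ℝ) ^ u / (Real.sqrt 2 * π) * Real.sqrt π * (2 * a) := by
                gcongr
            _ ≤ (9 : ℝ) ^ u / (Real.sqrt 2 * π) * Real.sqrt π * (ariasB u * a) := by
                gcongr
      _ = Real.sqrt π / (2 * (Real.sqrt 2 * π)) * (9 : ℝ) ^ u / a := by ring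
  have h2 : 1 / 7 * (2 : ℝ) ^ (3 * u / 2) * 1 / (a / 1.1) ^ (1 + 1) =
      1.21 / 7 * (2 : ℝ) ^ (3 * u / 2) / a ^ 2 := by
    rw [div_pow]; norm_num; ring
  rw [h2]
  linarith


/-- `1/(√2 π) ≤ 0.22509` and `√π ≤ 1.7725`. [folklore] -/
private theorem c0_le : 1 / (Real.sqrt 2 * π) ≤ 0.22509 ∧ Real.sqrt π ≤ 1.7725 := by
  have hπ := Real.pi_gt_d6
  have hπ' := Real.pi_lt_d6
  have h2 : (1.4142 : ℝ) ≤ Real.sqrt 2 := Real.le_sqrt_of_sq_le (by norm_num)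
  constructor
  · rw [div_le_iff₀ (by positivity)]
    nlinarith
  · rw [Real.sqrt_le_left (by norm_num)]
    nlinarith

/-- For `u ≤ 0` and `k ≥ 1`: `w_k ≤ 2^{−u} (1/(√2π)) Γ(k/2)/(2.25 a)^k`.
[cite: AriasDeReyna2011, Thm. 4.1, eq. (4.2)] -/
theorem ariasW_le_of_nonpos {u a : ℝ} (hu : u ≤ 0) (ha : 0 < a) {k : ℕ} (hk : k ≠ 0) :
    ariasW u a k ≤ (2 : ℝ) ^ (-u) / (Real.sqrt 2 * π) * Real.Gamma ((k : ℝ) / 2) / (2.25 * a) ^ k := by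
  rw [ariasW, if_neg hk, ariasC_of_nonpos hu, ariasB_of_nonpos hu]
  have hG : 0 < Real.Gamma ((k : ℝ) / 2) := Real.Gamma_pos_of_pos (by positivity)
  have hb := ariasB_neg_ge
  gcongr

/-- Numerical step for the `K = 6` regime (terms `k = 1, …, 4`). [folklore] -/
private theorem num6_low {a : ℝ} (ha : 3.98 ≤ a) :
    0.22509 * (1.7725 / (2.25 * a) ^ 1) + 0.22509 * (1 / (2.25 * a) ^ 2) +
      0.22509 * (1.7725 / 2 / (2.25 * a) ^ 3) + 0.22509 * (1 / (2.25 * a) ^ 4) ≤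
      0.1775 / a + 0.0445 / a ^ 2 + 0.0176 / a ^ 3 + 0.00879 / a ^ 4 := by
  have ha0 : 0 < a := by linarith
  have T1 : 0.22509 * (1.7725 / (2.25 * a) ^ 1) ≤ 0.1775 / a := by
    rw [pow_one, mul_div_assoc', div_le_div_iff₀ (by positivity) ha0]; nlinarith
  have T2 : 0.22509 * (1 / (2.25 * a) ^ 2) ≤ 0.0445 / a ^ 2 := by
    rw [mul_pow, mul_div_assoc', div_le_div_iff₀ (by positivity) (by positivity)]
    nlinarith [pow_pos ha0 2]
  have T3 : 0.22509 * (1.7725 / 2 / (2.25 * a) ^ 3) ≤ 0.0176 / a ^ 3 := by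
    rw [mul_pow, mul_div_assoc', div_le_div_iff₀ (by positivity) (by positivity)]
    nlinarith [pow_pos ha0 3]
  have T4 : 0.22509 * (1 / (2.25 * a) ^ 4) ≤ 0.00879 / a ^ 4 := by
    rw [mul_pow, mul_div_assoc', div_le_div_iff₀ (by positivity) (by positivity)]
    nlinarith [pow_pos ha0 4]
  linarith

/-- Numerical step for the `K = 6` regime (terms `k = 5, 6` and the remainder), using
`a ≥ 3.98`. [folklore] -/
private theorem num6_high {a : ℝ} (ha : 3.98 ≤ a) :
    0.22509 * (3 * 1.7725 / 4 / (2.25 * a) ^ 5) + 0.22509 * (2 / (2.25 * a) ^ 6) +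
      1 / 2 * (15 * 1.7725 / 8) * 1.1 ^ 7 / a ^ 7 ≤ 0.0612 / a ^ 4 := by
  have ha0 : 0 < a := by linarith
  have h4 : 0 < a ^ 4 := pow_pos ha0 4
  have h4a : 3.98 * a ^ 4 ≤ a ^ 5 := by nlinarith
  have h4b : 3.98 ^ 2 * a ^ 4 ≤ a ^ 6 := by nlinarith
  have h4c : 3.98 ^ 3 * a ^ 4 ≤ a ^ 7 := by nlinarith
  have T5 : 0.22509 * (3 * 1.7725 / 4 / (2.25 * a) ^ 5) ≤ 0.00131 / a ^ 4 := by
    rw [mul_pow, mul_div_assoc', div_le_div_iff₀ (by positivity) h4]; nlinarith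
  have T6 : 0.22509 * (2 / (2.25 * a) ^ 6) ≤ 0.00022 / a ^ 4 := by
    rw [mul_pow, mul_div_assoc', div_le_div_iff₀ (by positivity) h4]; nlinarith
  have T7 : 1 / 2 * (15 * 1.7725 / 8) * 1.1 ^ 7 / a ^ 7 ≤ 0.0515 / a ^ 4 := by
    rw [div_le_div_iff₀ (by positivity) h4]; nlinarith
  have : 0.00131 / a ^ 4 + 0.00022 / a ^ 4 + 0.0515 / a ^ 4 ≤ 0.0612 / a ^ 4 := by
    rw [← add_div, ← add_div]; gcongr; norm_num
  linarith

/-- **The regime `−4 ≤ u < 0`, `K = 6`** (admissible since `K + u ≥ 2`):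
`Σ_{k≤6} w_k + RS_6 ≤ 1/2 + 2^{−u}(0.1775/a + 0.0445/a² + 0.0176/a³ + 0.07/a⁴)` for `a ≥ 3.98`
(the values `Γ(1/2), …, Γ(7/2)`, `b ≥ 2.25`, `c₁ ≤ 1/2`, `2^{−u} ≥ 1`).
[cite: Polymath2019, Prop. 6.3, proof, eq. (laf)] -/
theorem ariasW_sum_le_neg {u a : ℝ} (hu : u < 0) (ha : 3.98 ≤ a) :
    ∑ k ∈ Finset.range 7, ariasW u a k + ariasRS u a 6 ≤
      1 / 2 + (2 : ℝ) ^ (-u) * (0.1775 / a + 0.0445 / a ^ 2 + 0.0176 / a ^ 3 + 0.07 / a ^ 4) := by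
  have ha0 : 0 < a := by linarith
  obtain ⟨hc0, hsπ⟩ := c0_le
  obtain ⟨hG1, hG3, hG5, hG7⟩ := Real_Gamma_halves
  have hX : 1 ≤ (2 : ℝ) ^ (-u) := Real.one_le_rpow (by norm_num) (by linarith)
  set X : ℝ := (2 : ℝ) ^ (-u) with hXdef
  have hXc : 0 ≤ X := by positivity
  have hp : 0 ≤ Real.sqrt π := Real.sqrt_nonneg _
  have hw : ∀ k : ℕ, k ≠ 0 → ariasW u a k ≤
      X * 0.22509 * (Real.Gamma ((k : ℝ) / 2) / (2.25 * a) ^ k) := fun k hk ↦ by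
    have h1 := ariasW_le_of_nonpos hu.le ha0 hk
    have hG : 0 ≤ Real.Gamma ((k : ℝ) / 2) := (Real.Gamma_pos_of_pos (by positivity)).le
    calc ariasW u a k
        ≤ (2 : ℝ) ^ (-u) / (Real.sqrt 2 * π) * Real.Gamma ((k : ℝ) / 2) / (2.25 * a) ^ k := h1
      _ = X * (1 / (Real.sqrt 2 * π)) * (Real.Gamma ((k : ℝ) / 2) / (2.25 * a) ^ k) := by
          rw [hXdef]; ring
      _ ≤ X * 0.22509 * (Real.Gamma ((k : ℝ) / 2) / (2.25 * a) ^ k) := by gcongr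
  have hRS : ariasRS u a 6 ≤ X * (1 / 2 * (15 * 1.7725 / 8) * 1.1 ^ 7 / a ^ 7) := by
    rw [ariasRS, show (((6 : ℕ) : ℝ) + 1) / 2 = 7 / 2 by norm_num, hG7, div_pow,
      div_div_eq_mul_div]
    have h1 : ariasC1 u ≤ 1 / 2 := ariasC1_le_half_of_neg hu
    have h2 : 0 ≤ ariasC1 u := (ariasC1_pos u).le
    calc ariasC1 u * (15 * Real.sqrt π / 8) * 1.1 ^ (6 + 1) / a ^ (6 + 1)
        ≤ 1 / 2 * (15 * 1.7725 / 8) * 1.1 ^ 7 / a ^ 7 := by gcongr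
      _ ≤ X * (1 / 2 * (15 * 1.7725 / 8) * 1.1 ^ 7 / a ^ 7) :=
          le_mul_of_one_le_left (by positivity) hX
  simp only [Finset.sum_range_succ, Finset.sum_range_zero, zero_add]
  have e0 : ariasW u a 0 = 1 / 2 := by simp [ariasW]
  have e1 := hw 1 one_ne_zero
  have e2 := hw 2 two_ne_zero
  have e3 := hw 3 (by norm_num)
  have e4 := hw 4 (by norm_num)
  have e5 := hw 5 (by norm_num)
  have e6 := hw 6 (by norm_num)
  rw [show ((1 : ℕ) : ℝ) / 2 = 1 / 2 by norm_num, hG1] at e1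
  rw [show ((2 : ℕ) : ℝ) / 2 = 1 by norm_num, Real.Gamma_one] at e2
  rw [show ((3 : ℕ) : ℝ) / 2 = 3 / 2 by norm_num, hG3] at e3
  rw [show ((4 : ℕ) : ℝ) / 2 = 2 by norm_num, Real.Gamma_two] at e4
  rw [show ((5 : ℕ) : ℝ) / 2 = 5 / 2 by norm_num, hG5] at e5
  rw [show ((6 : ℕ) : ℝ) / 2 = 3 by norm_num, Real_Gamma_three] at e6
  have e1' : ariasW u a 1 ≤ X * (0.22509 * (1.7725 / (2.25 * a) ^ 1)) :=
    e1.trans (by rw [mul_assoc]; gcongr)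
  have e3' : ariasW u a 3 ≤ X * (0.22509 * (1.7725 / 2 / (2.25 * a) ^ 3)) :=
    e3.trans (by rw [mul_assoc]; gcongr)
  have e5' : ariasW u a 5 ≤ X * (0.22509 * (3 * 1.7725 / 4 / (2.25 * a) ^ 5)) :=
    e5.trans (by rw [mul_assoc]; gcongr)
  have key := add_le_add (num6_low ha) (num6_high ha)
  have hsum : ariasW u a 1 + ariasW u a 2 + ariasW u a 3 + ariasW u a 4 + ariasW u a 5 +
      ariasW u a 6 + ariasRS u a 6 ≤
      X * (0.22509 * (1.7725 / (2.25 * a) ^ 1) + 0.22509 * (1 / (2.25 * a) ^ 2) +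
        0.22509 * (1.7725 / 2 / (2.25 * a) ^ 3) + 0.22509 * (1 / (2.25 * a) ^ 4) +
        (0.22509 * (3 * 1.7725 / 4 / (2.25 * a) ^ 5) + 0.22509 * (2 / (2.25 * a) ^ 6) +
          1 / 2 * (15 * 1.7725 / 8) * 1.1 ^ 7 / a ^ 7)) := by
    rw [mul_assoc] at e2 e4 e6
    nlinarith [e1', e2, e3', e4, e5', e6, hRS]
  have hfin : X * (0.22509 * (1.7725 / (2.25 * a) ^ 1) + 0.22509 * (1 / (2.25 * a) ^ 2) +
        0.22509 * (1.7725 / 2 / (2.25 * a) ^ 3) + 0.22509 * (1 / (2.25 * a) ^ 4) +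
        (0.22509 * (3 * 1.7725 / 4 / (2.25 * a) ^ 5) + 0.22509 * (2 / (2.25 * a) ^ 6) +
          1 / 2 * (15 * 1.7725 / 8) * 1.1 ^ 7 / a ^ 7)) ≤
      X * (0.1775 / a + 0.0445 / a ^ 2 + 0.0176 / a ^ 3 + 0.07 / a ^ 4) := by
    refine mul_le_mul_of_nonneg_left (key.trans ?_) hXc
    have : 0.00879 / a ^ 4 + 0.0612 / a ^ 4 ≤ 0.07 / a ^ 4 := by
      rw [← add_div]; gcongr; norm_num
    linarith
  rw [e0]
  linarith

/-- A crude bound for `Γ` on `[2, ∞)`: `Γ(x) ≤ e^{x(x−1)}` (`Γ(x) ≤ Γ(⌈x⌉) = (⌈x⌉−1)! ≤ (⌈x⌉−1)^{⌈x⌉−1}`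
and `log y ≤ y − 1`). [folklore] -/
private theorem Real_Gamma_le_exp_of_two_le {x : ℝ} (hx : 2 ≤ x) :
    Real.Gamma x ≤ Real.exp (x * (x - 1)) := by
  have hx0 : 0 ≤ x := by linarith
  have hc1 : 1 ≤ ⌈x⌉₊ := Nat.one_le_ceil_iff.2 (by linarith)
  obtain ⟨m, hm⟩ : ∃ m : ℕ, ⌈x⌉₊ = m + 1 := ⟨⌈x⌉₊ - 1, by omega⟩
  have hxn : x ≤ (m : ℝ) + 1 := by
    have := Nat.le_ceil x; rw [hm] at this; exact_mod_cast this
  have hmx : (m : ℝ) ≤ x := by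
    have := Nat.ceil_lt_add_one hx0; rw [hm] at this; push_cast at this; linarith
  have hm1 : (1 : ℝ) ≤ m := by linarith
  have h1 : Real.Gamma x ≤ Real.Gamma ((m : ℝ) + 1) :=
    Real.Gamma_strictMonoOn_Ici.monotoneOn (by simpa using hx)
      (by simp only [mem_Ici]; linarith) hxn
  rw [Real.Gamma_nat_eq_factorial] at h1
  have h3 : (m.factorial : ℝ) ≤ (m : ℝ) ^ m := by exact_mod_cast Nat.factorial_le_pow m
  have h4 : (m : ℝ) ^ m ≤ Real.exp (x * (x - 1)) := by
    rw [← Real.rpow_natCast, Real.rpow_def_of_pos (by linarith)]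
    refine Real.exp_le_exp.2 ?_
    have hlog : Real.log m ≤ m - 1 := Real.log_le_sub_one_of_pos (by linarith)
    have hlog0 : 0 ≤ Real.log m := Real.log_nonneg hm1
    nlinarith
  linarith

/-- In the far tail all `Γ(k/2)`, `1 ≤ k ≤ K`, are at most `√π Γ((K+1)/2)` (`K ≥ 3`). [folklore] -/
private theorem Gamma_half_le_far {K k : ℕ} (hK : 3 ≤ K) (hk1 : 1 ≤ k) (hkK : k ≤ K) :
    Real.Gamma ((k : ℝ) / 2) ≤ Real.sqrt π * Real.Gamma (((K : ℝ) + 1) / 2) := by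
  obtain ⟨hG1, hG3, -, -⟩ := Real_Gamma_halves
  have hK' : (3 : ℝ) ≤ K := by exact_mod_cast hK
  have hx2 : (2 : ℝ) ≤ ((K : ℝ) + 1) / 2 := by linarith
  have hG : 1 ≤ Real.Gamma (((K : ℝ) + 1) / 2) := by
    have := Real.Gamma_strictMonoOn_Ici.monotoneOn (by simp) (by simpa using hx2) hx2
    rwa [Real.Gamma_two] at this
  have hsπ : 1 ≤ Real.sqrt π := by
    rw [Real.le_sqrt (by norm_num) Real.pi_pos.le]; linarith [Real.pi_gt_three]
  have hπG : 1 ≤ Real.sqrt π * Real.Gamma (((K : ℝ) + 1) / 2) := one_le_mul_of_one_le_of_one_le hsπ hG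
  rcases le_or_gt k 3 with h3 | h4
  · interval_cases k
    · rw [show ((1 : ℕ) : ℝ) / 2 = 1 / 2 by norm_num, hG1]
      exact le_mul_of_one_le_right (Real.sqrt_nonneg _) hG
    · rw [show ((2 : ℕ) : ℝ) / 2 = 1 by norm_num, Real.Gamma_one]
      exact hπG
    · rw [show ((3 : ℕ) : ℝ) / 2 = 3 / 2 by norm_num, hG3]
      have := Real.sqrt_nonneg π
      nlinarith
  · have hk2 : (2 : ℝ) ≤ (k : ℝ) / 2 := by
      have : (4 : ℝ) ≤ k := by exact_mod_cast h4
      linarith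
    have hkx : (k : ℝ) / 2 ≤ ((K : ℝ) + 1) / 2 := by
      have : (k : ℝ) ≤ K := by exact_mod_cast hkK
      linarith
    calc Real.Gamma ((k : ℝ) / 2) ≤ Real.Gamma (((K : ℝ) + 1) / 2) :=
          Real.Gamma_strictMonoOn_Ici.monotoneOn (by simpa using hk2) (by simpa using hx2) hkx
      _ ≤ Real.sqrt π * Real.Gamma (((K : ℝ) + 1) / 2) :=
          le_mul_of_one_le_left (by linarith) hsπ

/-- **The far tail `u < −4`, `K = ⌈−u⌉ + 2`** (admissible since `K + u ≥ 2`): crudely,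
`Σ_{k≤K} w_k + RS_K ≤ 1/2 + (0.82/a) 2^{−u} e^{u²/4 + 3|u|/2 + 2}` for `a ≥ 3.98` (geometric series
in `1/(ba)`, `Γ(k/2) ≤ √π Γ((K+1)/2) ≤ √π e^{x(x−1)}`, `x = (K+1)/2 ≤ (|u|+4)/2`). The Gaussian
weight `e^{−(u−σ)²/t}` makes this negligible. [cite: Polymath2019, Prop. 6.3, proof, δ₃] -/
theorem ariasW_sum_le_far {u a : ℝ} (hu : u < -4) (ha : 3.98 ≤ a) :
    ∑ k ∈ Finset.range (⌈-u⌉₊ + 2 + 1), ariasW u a k + ariasRS u a (⌈-u⌉₊ + 2) ≤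
      1 / 2 + 0.82 / a * (2 : ℝ) ^ (-u) * Real.exp (u ^ 2 / 4 + 3 / 2 * |u| + 2) := by
  have ha0 : 0 < a := by linarith
  obtain ⟨hc0, hsπ⟩ := c0_le
  set K : ℕ := ⌈-u⌉₊ + 2 with hKdef
  have hcu : -u ≤ (⌈-u⌉₊ : ℝ) := Nat.le_ceil _
  have hcu' : (⌈-u⌉₊ : ℝ) < -u + 1 := Nat.ceil_lt_add_one (by linarith)
  have hc5 : 5 ≤ ⌈-u⌉₊ := by
    have : (4 : ℝ) < ⌈-u⌉₊ := by linarith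
    exact_mod_cast this
  have hK3 : 3 ≤ K := by omega
  have hKr : (K : ℝ) = ⌈-u⌉₊ + 2 := by rw [hKdef]; push_cast; ring
  set x : ℝ := ((K : ℝ) + 1) / 2 with hxdef
  have hx2 : 2 ≤ x := by rw [hxdef, hKr]; linarith
  have hxu : x ≤ (|u| + 4) / 2 := by rw [hxdef, hKr, abs_of_neg (by linarith)]; linarith
  set G : ℝ := Real.Gamma x with hGdef
  have hG0 : 0 < G := Real.Gamma_pos_of_pos (by linarith)
  have hGexp : G ≤ Real.exp (u ^ 2 / 4 + 3 / 2 * |u| + 2) := by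
    refine (Real_Gamma_le_exp_of_two_le hx2).trans (Real.exp_le_exp.2 ?_)
    have habs : |u| ^ 2 = u ^ 2 := sq_abs u
    have h0 : 0 ≤ |u| := abs_nonneg u
    nlinarith
  set X : ℝ := (2 : ℝ) ^ (-u) with hXdef
  have hX : 1 ≤ X := Real.one_le_rpow (by norm_num) (by linarith)
  -- the `C_k`-sum, by a geometric series in `r = 1/(2.25 a)`
  set r : ℝ := 1 / (2.25 * a) with hrdef
  have hr0 : 0 ≤ r := by positivity
  have hr1 : r < 1 := by rw [hrdef, div_lt_one (by positivity)]; linarith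
  have hterm : ∀ k ∈ Finset.range K, ariasW u a (k + 1) ≤
      X * (1 / (Real.sqrt 2 * π)) * (Real.sqrt π * G) * (r * r ^ k) := by
    intro k hk
    have hk' : k + 1 ≤ K := by simpa [Finset.mem_range] using hk
    have h1 := ariasW_le_of_nonpos (by linarith : u ≤ 0) ha0 (Nat.succ_ne_zero k)
    have h2 := Gamma_half_le_far hK3 (by omega) hk'
    calc ariasW u a (k + 1)
        ≤ (2 : ℝ) ^ (-u) / (Real.sqrt 2 * π) * Real.Gamma (((k + 1 : ℕ) : ℝ) / 2) /
            (2.25 * a) ^ (k + 1) := h1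
      _ = X * (1 / (Real.sqrt 2 * π)) * Real.Gamma (((k + 1 : ℕ) : ℝ) / 2) * (r * r ^ k) := by
          rw [hXdef, hrdef, ← pow_succ', div_pow, one_pow]; ring
      _ ≤ X * (1 / (Real.sqrt 2 * π)) * (Real.sqrt π * G) * (r * r ^ k) := by gcongr
  have hgeom : ∑ k ∈ Finset.range K, r ^ k ≤ 1 / (1 - r) := by
    have h := geom_sum_Ico_le_of_lt_one (m := 0) (n := K) hr0 hr1
    rw [pow_zero] at h
    rwa [Finset.range_eq_Ico]
  have hsumW : ∑ k ∈ Finset.range (K + 1), ariasW u a k ≤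
      1 / 2 + X * (1 / (Real.sqrt 2 * π)) * (Real.sqrt π * G) * (r * (1 / (1 - r))) := by
    rw [Finset.sum_range_succ']
    have e0 : ariasW u a 0 = 1 / 2 := by simp [ariasW]
    rw [e0, add_comm]
    gcongr
    calc ∑ k ∈ Finset.range K, ariasW u a (k + 1)
        ≤ ∑ k ∈ Finset.range K, X * (1 / (Real.sqrt 2 * π)) * (Real.sqrt π * G) * (r * r ^ k) :=
          Finset.sum_le_sum hterm
      _ = X * (1 / (Real.sqrt 2 * π)) * (Real.sqrt π * G) * (r * ∑ k ∈ Finset.range K, r ^ k) := by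
          rw [Finset.mul_sum, Finset.mul_sum]
      _ ≤ X * (1 / (Real.sqrt 2 * π)) * (Real.sqrt π * G) * (r * (1 / (1 - r))) := by gcongr
  -- `r/(1−r) = 1/(2.25a − 1) ≤ 1/(1.5 a)`
  have hr2 : r * (1 / (1 - r)) ≤ 1 / (1.5 * a) := by
    rw [hrdef]
    have h1 : 1 / (2.25 * a) * (1 / (1 - 1 / (2.25 * a))) = 1 / (2.25 * a - 1) := by
      field_simp
    rw [h1, div_le_div_iff₀ (by linarith) (by positivity)]
    linarith
  -- the remainder
  have hRS : ariasRS u a K ≤ X * (0.55 * G / a) := by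
    rw [ariasRS]
    have h1 : ariasC1 u ≤ 1 / 2 := ariasC1_le_half_of_neg (by linarith)
    have h2 : 0 ≤ ariasC1 u := (ariasC1_pos u).le
    have h3 : (1 : ℝ) / (a / 1.1) ^ (K + 1) ≤ 1.1 / a := by
      rw [one_div, ← inv_pow, inv_div]
      calc (1.1 / a) ^ (K + 1) ≤ (1.1 / a) ^ 1 :=
            pow_le_pow_of_le_one (by positivity) (by rw [div_le_one ha0]; linarith) (by omega)
        _ = 1.1 / a := pow_one _
    calc ariasC1 u * Real.Gamma (((K : ℝ) + 1) / 2) / (a / 1.1) ^ (K + 1)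
        = ariasC1 u * G * (1 / (a / 1.1) ^ (K + 1)) := by rw [hGdef, hxdef]; ring
      _ ≤ 1 / 2 * G * (1.1 / a) := by gcongr
      _ = 0.55 * G / a := by ring
      _ ≤ X * (0.55 * G / a) := le_mul_of_one_le_left (by positivity) hX
  -- assemble
  have hcs : 1 / (Real.sqrt 2 * π) * Real.sqrt π ≤ 0.22509 * 1.7725 :=
    mul_le_mul hc0 hsπ (Real.sqrt_nonneg _) (by norm_num)
  have hmain : X * (1 / (Real.sqrt 2 * π)) * (Real.sqrt π * G) * (r * (1 / (1 - r))) + X * (0.55 * G / a)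
      ≤ 0.82 / a * X * G := by
    have h1 : X * (1 / (Real.sqrt 2 * π)) * (Real.sqrt π * G) * (r * (1 / (1 - r)))
        ≤ X * (0.22509 * 1.7725) * G * (1 / (1.5 * a)) := by
      calc X * (1 / (Real.sqrt 2 * π)) * (Real.sqrt π * G) * (r * (1 / (1 - r)))
          = X * (1 / (Real.sqrt 2 * π) * Real.sqrt π) * G * (r * (1 / (1 - r))) := by ring
        _ ≤ X * (0.22509 * 1.7725) * G * (1 / (1.5 * a)) := by
            gcongr
    have h2 : X * (0.22509 * 1.7725) * G * (1 / (1.5 * a)) + X * (0.55 * G / a)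
        = (0.22509 * 1.7725 / 1.5 + 0.55) / a * X * G := by
      field_simp
    have h3 : (0.22509 * 1.7725 / 1.5 + 0.55) / a * X * G ≤ 0.82 / a * X * G := by
      have : 0 ≤ X * G / a := by positivity
      have h4 : (0.22509 * 1.7725 / 1.5 + 0.55 : ℝ) ≤ 0.82 := by norm_num
      calc (0.22509 * 1.7725 / 1.5 + 0.55) / a * X * G
          = (0.22509 * 1.7725 / 1.5 + 0.55) * (X * G / a) := by ring
        _ ≤ 0.82 * (X * G / a) := by gcongr
        _ = 0.82 / a * X * G := by ring
    linarith
  calc ∑ k ∈ Finset.range (K + 1), ariasW u a k + ariasRS u a K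
      ≤ 1 / 2 + X * (1 / (Real.sqrt 2 * π)) * (Real.sqrt π * G) * (r * (1 / (1 - r))) +
          X * (0.55 * G / a) := add_le_add hsumW hRS
    _ ≤ 1 / 2 + 0.82 / a * X * G := by linarith
    _ ≤ 1 / 2 + 0.82 / a * X * Real.exp (u ^ 2 / 4 + 3 / 2 * |u| + 2) := by gcongr

end Arias


/-! ## The pointwise bound for `R_{0,N}(u + iT')` (Stirling, Taylor expansion of `log M₀`) -/

section Pointwise

/-- `(1/8)(s(s−1)/2) π^{−s/2} Γ(s/2) = M₀(s) exp(1/(6s) + E)` with `|E| ≤ (π+1)/(4π T'²)` on the line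
`Im s = T' > 0` (complex Stirling formula with the `1/(12 z)` term kept, tree:
`GammaStirling.exists_Gamma_eq_exp_stirlingExp`). [cite: Polymath2019, Lemma 5.1 (v)] -/
theorem exists_xiFactor_eq_M₀_mul_exp' {s : ℂ} (hs : 0 < s.im) :
    ∃ E : ℂ, ‖E‖ ≤ (π + 1) / (4 * π * s.im ^ 2) ∧
      xiFactor s = M₀ s * Complex.exp (1 / (6 * s) + E) := by
  have hz : 0 < (s / 2).im := by rw [Complex.div_ofNat_im]; linarith
  obtain ⟨E, hE, hΓ⟩ :=
    Literature.Analysis.SpecialFunctions.GammaStirling.exists_Gamma_eq_exp_stirlingExp hz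
  refine ⟨E, ?_, ?_⟩
  · rw [Complex.div_ofNat_im] at hE
    convert hE using 1
    ring
  · have h12 : (1 : ℂ) / (12 * (s / 2)) = 1 / (6 * s) := by ring
    rw [xiFactor, hΓ, M₀, Literature.Analysis.SpecialFunctions.GammaStirling.stirlingExp, h12,
      show (s / 2 - 1 / 2) * Complex.log (s / 2) - s / 2 + 1 / (6 * s) + E =
        ((s / 2 - 1 / 2) * Complex.log (s / 2) - s / 2) + (1 / (6 * s) + E) by ring,
      Complex.exp_add]
    ring

/-- **Pointwise bound on the line `Im s = T'`** (`T' ≥ 4`): for real `u`,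
`|(1/8)(s(s−1)/2)π^{−s/2}Γ(s/2)|_{s = u+iT'} ≤ |M₀(iT')| a^{u} exp(u²/(4(T'−3)) + ((7/6)|u| + 0.33)/T'²)`,
`a = √(T'/2π)` — from `log M₀(u + iT') = log M₀(iT') + α(iT') u + O_≤(u²/(4(T'−3)))`
(`norm_logM₀_taylor_le`), `Re α(iT') = log a − 1/(1+T'²)` and the Stirling remainder
`Re(1/(6s)) + Re E ≤ |u|/(6T'²) + 0.33/T'²`. (Only real parts enter the modulus; the source's
`6|u|/(4(T−3))` is not needed.) [cite: Polymath2019, Prop. 6.3, proof] -/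
theorem norm_xiFactor_line_le {u T' : ℝ} (hT' : 4 ≤ T') :
    ‖xiFactor (u + T' * I)‖ ≤ ‖M₀ (I * T')‖ * Real.sqrt (T' / (2 * π)) ^ u *
      Real.exp (u ^ 2 / (4 * (T' - 3)) + (7 / 6 * |u| + 0.33) / T' ^ 2) := by
  have hT0 : 0 < T' := by linarith
  set s : ℂ := u + T' * I with hs
  have hsim : s.im = T' := by simp [hs]
  have hsre : s.re = u := by simp [hs]
  have hs0 : s ≠ 0 := fun h ↦ by have := congrArg Complex.im h; simp [hs] at this; linarith
  have hs1 : s ≠ 1 := fun h ↦ by have := congrArg Complex.im h; simp [hs] at this; linarith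
  have hI0 : I * (T' : ℂ) ≠ 0 := fun h ↦ by have := congrArg Complex.im h; simp at this; linarith
  have hI1 : I * (T' : ℂ) ≠ 1 := fun h ↦ by have := congrArg Complex.im h; simp at this; linarith
  -- Stirling
  obtain ⟨E, hE, hxi⟩ := exists_xiFactor_eq_M₀_mul_exp' (s := s) (by rw [hsim]; exact hT0)
  rw [hsim] at hE
  -- Taylor expansion of `log M₀` along the horizontal segment from `iT'` to `s`
  have htaylor := norm_logM₀_taylor_le (T₀ := T') (by linarith) (s := I * T') (h := u)
    (by simp) (by simp)
  have hsum : I * (T' : ℂ) + u = s := by rw [hs]; ring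
  rw [hsum] at htaylor
  set E₂ : ℂ := logM₀ s - logM₀ (I * T') - alpha (I * T') * u with hE₂
  have hE₂' : ‖E₂‖ ≤ u ^ 2 / (4 * (T' - 3)) := by
    refine htaylor.trans (le_of_eq ?_)
    rw [Complex.norm_real, Real.norm_eq_abs, sq_abs]; ring
  -- real parts
  obtain ⟨hαre, -⟩ := alpha_I_mul_re_im hT0
  set a : ℝ := Real.sqrt (T' / (2 * π)) with ha
  have ha0 : 0 < a := Real.sqrt_pos.2 (by positivity)
  have hloga : Real.log a = 1 / 2 * Real.log (T' / (2 * π)) := by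
    rw [ha, Real.log_sqrt (by positivity)]; ring
  have hre_logM₀ : (logM₀ s).re ≤ (logM₀ (I * T')).re + u * Real.log a + |u| / T' ^ 2 +
      u ^ 2 / (4 * (T' - 3)) := by
    have e : logM₀ s = logM₀ (I * T') + alpha (I * T') * u + E₂ := by rw [hE₂]; ring
    rw [e, Complex.add_re, Complex.add_re]
    have h1 : (alpha (I * T') * u).re = u * (alpha (I * ↑T')).re := by
      rw [Complex.mul_re, Complex.ofReal_re, Complex.ofReal_im]; ring
    rw [h1, hαre, hloga]
    have h2 : E₂.re ≤ u ^ 2 / (4 * (T' - 3)) := (Complex.re_le_norm _).trans hE₂'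
    have h3 : u * (-(1 + T' ^ 2)⁻¹) ≤ |u| / T' ^ 2 := by
      have h4 : (1 + T' ^ 2)⁻¹ ≤ (T' ^ 2)⁻¹ := by
        rw [inv_le_inv₀ (by positivity) (by positivity)]; linarith
      have h5 : 0 < (1 + T' ^ 2)⁻¹ := by positivity
      calc u * (-(1 + T' ^ 2)⁻¹) ≤ |u| * (1 + T' ^ 2)⁻¹ := by
            have := neg_abs_le u; have := le_abs_self u; nlinarith
        _ ≤ |u| * (T' ^ 2)⁻¹ := by gcongr
        _ = |u| / T' ^ 2 := by rw [div_eq_mul_inv]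
    nlinarith
  -- the Stirling correction
  have hcorr : (1 / (6 * s) + E).re ≤ |u| / (6 * T' ^ 2) + 0.33 / T' ^ 2 := by
    rw [Complex.add_re]
    have h1 : (1 / (6 * s)).re = u / (6 * (u ^ 2 + T' ^ 2)) := by
      have hne : (u ^ 2 + T' ^ 2) ≠ 0 := by positivity
      rw [hs, one_div, Complex.inv_re, Complex.normSq_apply]
      simp
      field_simp
    have h2 : u / (6 * (u ^ 2 + T' ^ 2)) ≤ |u| / (6 * T' ^ 2) := by
      calc u / (6 * (u ^ 2 + T' ^ 2)) ≤ |u| / (6 * (u ^ 2 + T' ^ 2)) := by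
            gcongr; exact le_abs_self u
        _ ≤ |u| / (6 * T' ^ 2) := by gcongr; nlinarith
    have h3 : E.re ≤ 0.33 / T' ^ 2 := by
      refine (Complex.re_le_norm E).trans (hE.trans ?_)
      rw [div_le_div_iff₀ (by positivity) (by positivity)]
      have := Real.pi_gt_d2
      nlinarith [sq_nonneg T']
    linarith
  -- assemble
  rw [hxi, norm_mul, Complex.norm_exp, M₀_eq_exp_logM₀ hs0 hs1, Complex.norm_exp,
    M₀_eq_exp_logM₀ hI0 hI1, Complex.norm_exp, Real.rpow_def_of_pos ha0, ← Real.exp_add,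
    ← Real.exp_add, ← Real.exp_add]
  refine Real.exp_le_exp.2 ?_
  have : |u| / T' ^ 2 + |u| / (6 * T' ^ 2) + 0.33 / T' ^ 2 = (7 / 6 * |u| + 0.33) / T' ^ 2 := by
    field_simp; ring
  nlinarith [this, mul_comm u (Real.log a)]

/-- **`R_{0,N}` on the line `Im s = T'` against Arias de Reyna's majorant**: for `T' ≥ 4`,
`a = √(T'/2π)`, `N = ⌊a⌋` and admissible `K`,
`|R_{0,N}(u + iT')| ≤ |M₀(iT')| e^{u²/(4(T'−3)) + ((7/6)|u|+0.33)/T'²} (Σ_{k≤K} w_k + RS_K)`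
(the factors `a^{u}` and `a^{−u}` cancel). [cite: Polymath2019, Prop. 6.3, proof, display (rtnst)] -/
theorem norm_R0_line_le (h : arias_lehmer_rs_bound) {u T' : ℝ} (hT' : 4 ≤ T') {K : ℕ}
    (hK : 1 ≤ K) (huK : 0 ≤ u ∨ (2 : ℝ) ≤ K + u) :
    ‖R0 ⌊Real.sqrt (T' / (2 * π))⌋₊ (u + T' * I)‖ ≤
      ‖M₀ (I * T')‖ * Real.exp (u ^ 2 / (4 * (T' - 3)) + (7 / 6 * |u| + 0.33) / T' ^ 2) *
        (∑ k ∈ Finset.range (K + 1), ariasW u (Real.sqrt (T' / (2 * π))) k +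
          ariasRS u (Real.sqrt (T' / (2 * π))) K) := by
  have hT0 : 0 < T' := by linarith
  set a : ℝ := Real.sqrt (T' / (2 * π)) with ha
  have ha0 : 0 < a := Real.sqrt_pos.2 (by positivity)
  have h1 := norm_xiFactor_line_le (u := u) hT'
  have h2 := norm_rsLineIntegral_le_ariasW h hT0 hK huK
  rw [← ha] at h1 h2
  have hcast : ((⌊a⌋₊ : ℕ) : ℝ) + 1 / 2 = (⌊a⌋₊ + 1 / 2 : ℝ) := rfl
  rw [R0, norm_mul]
  have hS : 0 ≤ ∑ k ∈ Finset.range (K + 1), ariasW u a k + ariasRS u a K := by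
    refine add_nonneg (Finset.sum_nonneg fun k _ ↦ ?_) ?_
    · unfold ariasW; split_ifs
      · norm_num
      · exact div_nonneg (mul_nonneg (ariasC_pos u).le (Real.Gamma_pos_of_pos (by positivity)).le)
          (pow_nonneg (mul_nonneg (ariasB_pos u).le ha0.le) _)
    · exact div_nonneg (mul_nonneg (ariasC1_pos u).le (Real.Gamma_pos_of_pos (by positivity)).le)
        (pow_nonneg (by positivity) _)
  calc ‖xiFactor (u + T' * I)‖ * ‖rsLineIntegral (⌊a⌋₊ + 1 / 2) (u + T' * I)‖
      ≤ (‖M₀ (I * T')‖ * a ^ u * Real.exp (u ^ 2 / (4 * (T' - 3)) + (7 / 6 * |u| + 0.33) / T' ^ 2)) *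
          (a ^ (-u) * (∑ k ∈ Finset.range (K + 1), ariasW u a k + ariasRS u a K)) :=
        mul_le_mul h1 h2 (norm_nonneg _) (by positivity)
    _ = _ := by
        rw [Real.rpow_neg ha0.le]
        field_simp

end Pointwise


/-! ## The corrected majorant `ε̃♯` and the Gaussian integrals behind it -/

section EpsSharp

/-- The quadratic coefficient `κ = 1/(4(T−8))`, a majorant of `1/(4(T'−3)) + 7/(6T'²)`.
[cite: Polymath2019, Prop. 6.3, proof] -/
def kapS (T : ℝ) : ℝ := 1 / (4 * (T - 8))

/-- The Gaussian average of `e^{κu² + cu}`, `u = σ + √t v`, against `(1/√π)e^{−v²}`: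
`F(t,σ,κ,c) = (1 − κt)^{−1/2} exp(κσ² + cσ + t(2κσ + c)²/(4(1 − κt)))` (eq. (gaussian) of the
source). [cite: Polymath2019, §6 eq. (gaussian) and Prop. 6.3, proof, eq. (delta1)] -/
def gaussF (t σ κ c : ℝ) : ℝ :=
  Real.sqrt (1 / (1 - κ * t)) *
    Real.exp (κ * σ ^ 2 + c * σ + t * (2 * κ * σ + c) ^ 2 / (4 * (1 - κ * t)))

/-- The half-line factor for the `2^{−u}` family: the Gaussian mass of `u < 0` relative to the full
line is at most `(1/2) exp(−(σ − (t/2) log 2)²/t)` when `σ ≥ (t/2) log 2` (and `≤ 1` always);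
our replacement for the source's full-line treatment of `δ₂`. [cite: Polymath2019, Prop. 6.3, proof, δ₂] -/
def tauS (t σ : ℝ) : ℝ :=
  if Real.log 2 * t / 2 ≤ σ then 1 / 2 * Real.exp (-(σ - Real.log 2 * t / 2) ^ 2 / t) else 1

/-- **The corrected error `ε̃♯(σ + iT)` of Prop. 6.3** (replacing the printed
`ε̃ = (0.397·9^σ/(a − 0.865) + 5/(3(T−6))) e^{3.49/(T−4)}`, whose constant `0.397` rests on the
mis-copied value `0.036` for Arias de Reyna's `2^{1/2}/(2π) = 0.2251` in Prop. 6.2, `σ ≤ 0`):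
with `a = √(T'/2π)`, `T' = T + πt/8`, `κ = 1/(4(T−8))`,
`ε̃♯ = e^{0.63/T²}[½F(0) + 0.1995 F(log 9)/a + 0.1729 F((3/2)log 2)/a²`
`       + (0.1775/a + 0.0445/a² + 0.0176/a³ + 0.07/a⁴) F(−log 2) τ♯] + 10⁻⁷/a − 1/2`.
The families: `9^u` and `2^{3u/2}` (Arias, `σ > 0`, `K = 1`), `2^{−u}` (`σ ≤ 0`, `K = 6`, restricted to
`u < 0` by `τ♯`), and the far tail `u < −4` (`10⁻⁷/a`). [cite: Polymath2019, Prop. 6.3] -/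
def epsSharp (t σ T : ℝ) : ℝ :=
  Real.exp (0.63 / T ^ 2) *
      (1 / 2 * gaussF t σ (kapS T) 0 + 0.1995 * gaussF t σ (kapS T) (Real.log 9) / rsA t T +
        0.1729 * gaussF t σ (kapS T) (3 / 2 * Real.log 2) / rsA t T ^ 2 +
        (0.1775 / rsA t T + 0.0445 / rsA t T ^ 2 + 0.0176 / rsA t T ^ 3 + 0.07 / rsA t T ^ 4) *
          gaussF t σ (kapS T) (-Real.log 2) * tauS t σ) +
    1e-7 / rsA t T - 1 / 2

variable {t σ T : ℝ}

/-- The quadratic majorant of the pointwise exponent: for `T ≥ 100`, `0 ≤ t ≤ 1/2`,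
`T' = T + πt/8` and all real `u`,
`u²/(4(T'−3)) + ((7/6)|u| + 0.33)/T'² ≤ κ u² + 0.63/T²`, `κ = 1/(4(T−8))` (using
`|u| ≤ u² + 1/4`). [cite: Polymath2019, Prop. 6.3, proof] -/
theorem q_le (hT : 100 ≤ T) (ht : 0 ≤ t) (ht' : t ≤ 1 / 2) (u : ℝ) :
    u ^ 2 / (4 * (T + π * t / 8 - 3)) + (7 / 6 * |u| + 0.33) / (T + π * t / 8) ^ 2 ≤
      kapS T * u ^ 2 + 0.63 / T ^ 2 := by
  have hπ := Real.pi_lt_d2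
  have hπ0 := Real.pi_pos
  set T' := T + π * t / 8 with hT'
  have hT'1 : T ≤ T' := by rw [hT']; nlinarith
  have hT'2 : T' ≤ T + 0.2 := by rw [hT']; nlinarith
  have hT0 : 0 < T := by linarith
  have habs : |u| ≤ u ^ 2 + 1 / 4 := by
    rw [← sq_abs]; nlinarith [sq_nonneg (|u| - 1 / 2), abs_nonneg u]
  have h1 : (7 / 6 * |u| + 0.33) / T' ^ 2 ≤ (7 / 6 * u ^ 2 + 0.63) / T ^ 2 := by
    have : (7 / 6 * |u| + 0.33) / T' ^ 2 ≤ (7 / 6 * |u| + 0.33) / T ^ 2 := by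
      gcongr
    refine this.trans ?_
    gcongr ?_ / _
    linarith
  have h2 : u ^ 2 / (4 * (T' - 3)) + 7 / 6 * u ^ 2 / T ^ 2 ≤ kapS T * u ^ 2 := by
    rw [kapS]
    have hu : 0 ≤ u ^ 2 := sq_nonneg u
    have key : 1 / (4 * (T' - 3)) + 7 / 6 / T ^ 2 ≤ 1 / (4 * (T - 8)) := by
      have hden : 0 < 4 * (T' - 3) * T ^ 2 := mul_pos (mul_pos (by norm_num) (by linarith)) (by positivity)
      rw [div_add_div _ _ (by linarith) (by positivity), div_le_div_iff₀ hden (by linarith)]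
      nlinarith
    calc u ^ 2 / (4 * (T' - 3)) + 7 / 6 * u ^ 2 / T ^ 2
        = (1 / (4 * (T' - 3)) + 7 / 6 / T ^ 2) * u ^ 2 := by ring
      _ ≤ 1 / (4 * (T - 8)) * u ^ 2 := by gcongr
  have h3 : (7 / 6 * u ^ 2 + 0.63) / T ^ 2 = 7 / 6 * u ^ 2 / T ^ 2 + 0.63 / T ^ 2 := by ring
  linarith

/-- `0 ≤ κ ≤ 0.0028` and `0 < 1 − κt ≤ 1` for `T ≥ 100`, `0 ≤ t ≤ 1/2`.
[cite: Polymath2019, Prop. 6.3, proof] -/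
theorem kapS_bounds (hT : 100 ≤ T) (ht : 0 ≤ t) (ht' : t ≤ 1 / 2) :
    0 ≤ kapS T ∧ kapS T ≤ 0.0028 ∧ 0 < 1 - kapS T * t ∧ 1 - kapS T * t ≤ 1 := by
  have h1 : 0 ≤ kapS T := by rw [kapS]; exact div_nonneg zero_le_one (by linarith)
  have h2 : kapS T ≤ 0.0028 := by
    rw [kapS, div_le_iff₀ (by linarith)]; nlinarith
  refine ⟨h1, h2, by nlinarith, by nlinarith⟩

/-- **Evaluation of the Gaussian averages**: for `1 − κt > 0`,
`∫ (1/√π) e^{−v²} e^{κu² + cu + q₀} dv = e^{q₀} F(t,σ,κ,c)`, `u = σ + √t v`.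
[cite: Polymath2019, §6 eq. (gaussian)] -/
theorem integral_gauss_family (ht : 0 ≤ t) {κ c q₀ : ℝ} (hA : 0 < 1 - κ * t) :
    ∫ v : ℝ, Real.exp (-v ^ 2) / Real.sqrt π *
        Real.exp (κ * (σ + Real.sqrt t * v) ^ 2 + c * (σ + Real.sqrt t * v) + q₀) =
      Real.exp q₀ * gaussF t σ κ c := by
  have hπ : 0 < Real.sqrt π := Real.sqrt_pos.2 Real.pi_pos
  have ht2 : Real.sqrt t ^ 2 = t := Real.sq_sqrt ht
  have hform : ∀ v : ℝ, Real.exp (-v ^ 2) / Real.sqrt π *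
      Real.exp (κ * (σ + Real.sqrt t * v) ^ 2 + c * (σ + Real.sqrt t * v) + q₀) =
      (1 / Real.sqrt π) * Real.exp (-(1 - κ * t) * v ^ 2 + (2 * κ * σ + c) * Real.sqrt t * v +
        (κ * σ ^ 2 + c * σ + q₀)) := fun v ↦ by
    rw [div_eq_mul_inv, mul_right_comm, ← Real.exp_add, one_div, mul_comm]
    congr 2
    have key : (σ + Real.sqrt t * v) ^ 2 = σ ^ 2 + 2 * σ * Real.sqrt t * v + t * v ^ 2 := by
      rw [add_sq, mul_pow, ht2]; ring
    rw [key]; ring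
  simp_rw [hform]
  rw [integral_const_mul, integral_exp_quad hA, gaussF]
  have h1 : 1 / Real.sqrt π * Real.sqrt (π / (1 - κ * t)) = Real.sqrt (1 / (1 - κ * t)) := by
    rw [Real.sqrt_div' π hA.le, Real.sqrt_div' 1 hA.le, Real.sqrt_one]
    field_simp
  rw [← mul_assoc, h1, mul_left_comm, ← Real.exp_add]
  congr 2
  rw [mul_pow, ht2]
  field_simp
  ring

/-- Integrability of the Gaussian families. [cite: Polymath2019, §6, eq. (gaussian)] -/
theorem integrable_gauss_family (ht : 0 ≤ t) {κ c q₀ : ℝ} (hA : 0 < 1 - κ * t) :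
    Integrable fun v : ℝ ↦ Real.exp (-v ^ 2) / Real.sqrt π *
        Real.exp (κ * (σ + Real.sqrt t * v) ^ 2 + c * (σ + Real.sqrt t * v) + q₀) := by
  have ht2 : Real.sqrt t ^ 2 = t := Real.sq_sqrt ht
  have hform : ∀ v : ℝ, Real.exp (-v ^ 2) / Real.sqrt π *
      Real.exp (κ * (σ + Real.sqrt t * v) ^ 2 + c * (σ + Real.sqrt t * v) + q₀) =
      (1 / Real.sqrt π) * Real.exp (-(1 - κ * t) * v ^ 2 + (2 * κ * σ + c) * Real.sqrt t * v +
        (κ * σ ^ 2 + c * σ + q₀)) := fun v ↦ by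
    rw [div_eq_mul_inv, mul_right_comm, ← Real.exp_add, one_div, mul_comm]
    congr 2
    have key : (σ + Real.sqrt t * v) ^ 2 = σ ^ 2 + 2 * σ * Real.sqrt t * v + t * v ^ 2 := by
      rw [add_sq, mul_pow, ht2]; ring
    rw [key]; ring
  simp_rw [hform]
  exact (integrable_exp_quad hA _ _).const_mul _

/-- **The half-line Gaussian average of the `2^{−u}` family**: for `0 ≤ κ`, `1 − κt > 0`, `t > 0`,
`∫ 1_{u<0} (1/√π) e^{−v²} e^{κu² − u log 2 + q₀} dv ≤ e^{q₀} F(t,σ,κ,−log 2) τ♯(t,σ)`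
(complete the square; for `σ ≥ (t/2)log 2` the centre of the Gaussian lies to the right of the
cut `u = 0` and `(v−μ)² ≥ (v−v₀)² + (v₀−μ)²`). [cite: Polymath2019, Prop. 6.3, proof, δ₂] -/
theorem integral_gauss_half_le (ht : 0 < t) {κ q₀ : ℝ} (hκ : 0 ≤ κ) (hA : 0 < 1 - κ * t) :
    ∫ v : ℝ, (Iio (-σ / Real.sqrt t)).indicator (fun v ↦ Real.exp (-v ^ 2) / Real.sqrt π *
        Real.exp (κ * (σ + Real.sqrt t * v) ^ 2 + (-Real.log 2) * (σ + Real.sqrt t * v) + q₀)) v ≤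
      Real.exp q₀ * gaussF t σ κ (-Real.log 2) * tauS t σ := by
  have hπ : 0 < Real.sqrt π := Real.sqrt_pos.2 Real.pi_pos
  have hst : 0 < Real.sqrt t := Real.sqrt_pos.2 ht
  have ht2 : Real.sqrt t ^ 2 = t := Real.sq_sqrt ht.le
  set A : ℝ := 1 - κ * t with hAdef
  set B : ℝ := (2 * κ * σ + -Real.log 2) * Real.sqrt t with hB
  set C : ℝ := κ * σ ^ 2 + -Real.log 2 * σ + q₀ with hC
  set μ : ℝ := B / (2 * A) with hμ
  set v₀ : ℝ := -σ / Real.sqrt t with hv₀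
  -- completing the square
  have hform : ∀ v : ℝ, Real.exp (-v ^ 2) / Real.sqrt π *
      Real.exp (κ * (σ + Real.sqrt t * v) ^ 2 + (-Real.log 2) * (σ + Real.sqrt t * v) + q₀) =
      (Real.exp (B ^ 2 / (4 * A) + C) / Real.sqrt π) * Real.exp (-A * (v - μ) ^ 2) := fun v ↦ by
    rw [div_mul_eq_mul_div, ← Real.exp_add, div_mul_eq_mul_div, ← Real.exp_add]
    congr 2
    have key : (σ + Real.sqrt t * v) ^ 2 = σ ^ 2 + 2 * σ * Real.sqrt t * v + t * v ^ 2 := by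
      rw [add_sq, mul_pow, ht2]; ring
    have step1 : -v ^ 2 + (κ * (σ + Real.sqrt t * v) ^ 2 + -Real.log 2 * (σ + Real.sqrt t * v) + q₀)
        = -A * v ^ 2 + B * v + C := by
      rw [key, hAdef, hB, hC]; ring
    have step2 : -A * v ^ 2 + B * v + C = B ^ 2 / (4 * A) + C + -A * (v - μ) ^ 2 := by
      rw [hμ]; field_simp; ring
    rw [step1, step2]
  simp_rw [hform]
  have hval : Real.exp (B ^ 2 / (4 * A) + C) / Real.sqrt π * Real.sqrt (π / A) =
      Real.exp q₀ * gaussF t σ κ (-Real.log 2) := by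
    rw [gaussF, Real.sqrt_div' π hA.le, Real.sqrt_div' 1 hA.le, Real.sqrt_one, hAdef,
      mul_comm (Real.exp q₀), mul_assoc, ← Real.exp_add]
    have : B ^ 2 / (4 * A) + C =
        κ * σ ^ 2 + -Real.log 2 * σ + t * (2 * κ * σ + -Real.log 2) ^ 2 / (4 * (1 - κ * t)) + q₀ := by
      rw [hB, hC, hAdef, mul_pow, ht2]; ring
    rw [this]
    field_simp
  have hpos : 0 ≤ Real.exp (B ^ 2 / (4 * A) + C) / Real.sqrt π := by positivity
  rw [integral_indicator measurableSet_Iio, integral_const_mul, ← integral_indicator measurableSet_Iio]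
  · by_cases hσ : Real.log 2 * t / 2 ≤ σ
    · -- centre to the right of the cut
      have hvμ : v₀ ≤ μ := by
        rw [hv₀, hμ, hB, hAdef, div_le_div_iff₀ hst (by positivity)]
        have : -σ * (2 * (1 - κ * t)) ≤ (2 * κ * σ + -Real.log 2) * Real.sqrt t * Real.sqrt t := by
          rw [mul_assoc, Real.mul_self_sqrt ht.le]; nlinarith
        linarith
      have h1 := integral_indicator_Iio_exp_le (μ := μ) (v₀ := v₀) hA hvμ
      rw [tauS, if_pos hσ]
      calc Real.exp (B ^ 2 / (4 * A) + C) / Real.sqrt π *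
            ∫ v : ℝ, (Iio v₀).indicator (fun v ↦ Real.exp (-A * (v - μ) ^ 2)) v
          ≤ Real.exp (B ^ 2 / (4 * A) + C) / Real.sqrt π *
              (Real.sqrt (π / A) / 2 * Real.exp (-A * (v₀ - μ) ^ 2)) := by gcongr
        _ = Real.exp q₀ * gaussF t σ κ (-Real.log 2) * (1 / 2 * Real.exp (-A * (v₀ - μ) ^ 2)) := by
            rw [← hval]; ring
        _ ≤ Real.exp q₀ * gaussF t σ κ (-Real.log 2) *
              (1 / 2 * Real.exp (-(σ - Real.log 2 * t / 2) ^ 2 / t)) := by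
            have hg : 0 ≤ Real.exp q₀ * gaussF t σ κ (-Real.log 2) := by rw [gaussF]; positivity
            gcongr
            -- `A (v₀ − μ)² = (σ − (t/2) log 2)²/(A t) ≥ (σ − (t/2) log 2)²/t`
            have hd : v₀ - μ = -(σ - Real.log 2 * t / 2) / (A * Real.sqrt t) := by
              have hA' : 1 - κ * t ≠ 0 := by rw [← hAdef]; exact hA.ne'
              rw [hv₀, hμ, hB, hAdef]
              field_simp
              rw [ht2]
              ring
            have hid : A * (v₀ - μ) ^ 2 = (σ - Real.log 2 * t / 2) ^ 2 / (A * t) := by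
              rw [hd, div_pow, neg_sq, mul_pow, ht2]
              field_simp
            rw [neg_mul, hid, neg_div, neg_le_neg_iff]
            exact div_le_div_of_nonneg_left (sq_nonneg _) (by positivity)
              (by rw [hAdef]; nlinarith [mul_nonneg hκ (mul_self_nonneg t)])
    · rw [tauS, if_neg hσ, mul_one]
      calc Real.exp (B ^ 2 / (4 * A) + C) / Real.sqrt π *
            ∫ v : ℝ, (Iio v₀).indicator (fun v ↦ Real.exp (-A * (v - μ) ^ 2)) v
          ≤ Real.exp (B ^ 2 / (4 * A) + C) / Real.sqrt π * Real.sqrt (π / A) := by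
            gcongr; exact integral_indicator_Iio_exp_le' hA μ v₀
        _ = Real.exp q₀ * gaussF t σ κ (-Real.log 2) := hval


/-- **Far-tail pointwise bound** (`u = σ + √t v < −4`, so `|u| ≤ √t|v| ≤ |v|/√2`, `|v| ≥ 4√2`):
`(1/√π)e^{−v²} e^{κu²+q₀} (0.82/a) 2^{−u} e^{u²/4 + 3|u|/2 + 2} ≤ (0.82/(a√π)) e^{−v²/2}`.
[cite: Polymath2019, Prop. 6.3, proof, δ₃] -/
theorem far_pointwise (ht : 0 < t) (ht' : t ≤ 1 / 2) (hσ : 0 ≤ σ) {κ q₀ a v : ℝ} (hκ0 : 0 ≤ κ)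
    (hκ : κ ≤ 0.0028) (hq : q₀ ≤ 0.0001) (ha : 0 < a)
    (hv : σ + Real.sqrt t * v < -4) :
    Real.exp (-v ^ 2) / Real.sqrt π *
        Real.exp (κ * (σ + Real.sqrt t * v) ^ 2 + q₀) *
        (0.82 / a * (2 : ℝ) ^ (-(σ + Real.sqrt t * v)) *
          Real.exp ((σ + Real.sqrt t * v) ^ 2 / 4 + 3 / 2 * |σ + Real.sqrt t * v| + 2)) ≤
      0.82 / (a * Real.sqrt π) * Real.exp (-v ^ 2 / 2) := by
  have hπ : 0 < Real.sqrt π := Real.sqrt_pos.2 Real.pi_pos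
  have hst : 0 < Real.sqrt t := Real.sqrt_pos.2 ht
  have hst' : Real.sqrt t ≤ 0.7072 := by
    rw [Real.sqrt_le_left (by norm_num)]; linarith
  set u : ℝ := σ + Real.sqrt t * v with hu
  have hv0 : v < 0 := by
    by_contra h
    have : 0 ≤ Real.sqrt t * v := mul_nonneg hst.le (not_lt.1 h)
    linarith
  set w : ℝ := -v with hw
  have hw0 : 0 < w := by linarith
  have habs : |u| = -u := abs_of_neg (by linarith)
  have hu1 : -u ≤ Real.sqrt t * w := by rw [hu, hw]; nlinarith
  have hu2 : -u ≤ 0.7072 * w := hu1.trans (by nlinarith)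
  have hw1 : 5.656 ≤ w := by nlinarith
  have hu3 : u ^ 2 ≤ 0.7072 ^ 2 * w ^ 2 := by nlinarith
  have hlog2 := Real.log_two_lt_d9
  have hlog2' : 0 < Real.log 2 := Real.log_pos (by norm_num)
  rw [Real.rpow_def_of_pos (by norm_num : (0:ℝ) < 2), habs]
  have hexp : -v ^ 2 + (κ * u ^ 2 + q₀) + (Real.log 2 * -u + (u ^ 2 / 4 + 3 / 2 * -u + 2))
      ≤ -v ^ 2 / 2 := by
    have hv2 : v ^ 2 = w ^ 2 := by rw [hw]; ring
    rw [hv2]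
    nlinarith [mul_nonneg hκ0 (sq_nonneg u), mul_le_mul_of_nonneg_left hu2 hlog2'.le]
  have e : Real.exp (-v ^ 2) * Real.exp (κ * u ^ 2 + q₀) *
      (Real.exp (Real.log 2 * -u) * Real.exp (u ^ 2 / 4 + 3 / 2 * -u + 2)) =
      Real.exp (-v ^ 2 + (κ * u ^ 2 + q₀) + (Real.log 2 * -u + (u ^ 2 / 4 + 3 / 2 * -u + 2))) := by
    rw [← Real.exp_add, ← Real.exp_add, ← Real.exp_add]
  calc Real.exp (-v ^ 2) / Real.sqrt π * Real.exp (κ * u ^ 2 + q₀) *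
        (0.82 / a * Real.exp (Real.log 2 * -u) * Real.exp (u ^ 2 / 4 + 3 / 2 * -u + 2))
      = 0.82 / (a * Real.sqrt π) * (Real.exp (-v ^ 2) * Real.exp (κ * u ^ 2 + q₀) *
          (Real.exp (Real.log 2 * -u) * Real.exp (u ^ 2 / 4 + 3 / 2 * -u + 2))) := by ring
    _ = 0.82 / (a * Real.sqrt π) *
          Real.exp (-v ^ 2 + (κ * u ^ 2 + q₀) + (Real.log 2 * -u + (u ^ 2 / 4 + 3 / 2 * -u + 2))) := by
        rw [e]
    _ ≤ 0.82 / (a * Real.sqrt π) * Real.exp (-v ^ 2 / 2) := by gcongr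

/-- `e^{−16} ≤ 1.13·10⁻⁷`. [folklore] -/
private theorem exp_neg_sixteen_le : Real.exp (-16) ≤ 1.13e-7 := by
  have h1 : (2.718 : ℝ) ^ 16 ≤ Real.exp 16 := by
    have := Real.exp_one_gt_d9
    have h : (2.718 : ℝ) ≤ Real.exp 1 := by linarith
    calc (2.718 : ℝ) ^ 16 ≤ Real.exp 1 ^ 16 := by gcongr
      _ = Real.exp 16 := by rw [← Real.exp_nat_mul]; norm_num
  rw [Real.exp_neg, inv_le_comm₀ (Real.exp_pos _) (by norm_num)]
  refine le_trans ?_ h1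
  norm_num

/-- **The far-tail integral is negligible**:
`∫ 1_{v < −(4+σ)/√t} (0.82/(a√π)) e^{−v²/2} dv ≤ 10⁻⁷/a` (`(4+σ)²/(2t) ≥ 16`).
[cite: Polymath2019, Prop. 6.3, proof, δ₃] -/
theorem far_integral_le (ht : 0 < t) (ht' : t ≤ 1 / 2) (hσ : 0 ≤ σ) {a : ℝ} (ha : 0 < a) :
    ∫ v : ℝ, (Iio (-(4 + σ) / Real.sqrt t)).indicator
        (fun v ↦ 0.82 / (a * Real.sqrt π) * Real.exp (-v ^ 2 / 2)) v ≤ 1e-7 / a := by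
  have hπ : 0 < Real.sqrt π := Real.sqrt_pos.2 Real.pi_pos
  have hst : 0 < Real.sqrt t := Real.sqrt_pos.2 ht
  set v₁ : ℝ := -(4 + σ) / Real.sqrt t with hv₁
  have hv₁0 : v₁ ≤ 0 := by rw [hv₁]; exact div_nonpos_of_nonpos_of_nonneg (by linarith) hst.le
  have hform : ∀ v : ℝ, 0.82 / (a * Real.sqrt π) * Real.exp (-v ^ 2 / 2)
      = 0.82 / (a * Real.sqrt π) * Real.exp (-(1 / 2) * (v - 0) ^ 2) := fun v ↦ by
    congr 2; ring
  simp_rw [hform]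
  rw [integral_indicator measurableSet_Iio, integral_const_mul, ← integral_indicator measurableSet_Iio]
  have h1 := integral_indicator_Iio_exp_le (A := 1 / 2) (μ := 0) (v₀ := v₁) (by norm_num) hv₁0
  have htail : Real.exp (-(1 / 2) * (v₁ - 0) ^ 2) ≤ 1.13e-7 := by
    refine le_trans (Real.exp_le_exp.2 ?_) exp_neg_sixteen_le
    have hsq : (v₁ - 0) ^ 2 = (4 + σ) ^ 2 / t := by
      rw [sub_zero, hv₁, div_pow, neg_sq, Real.sq_sqrt ht.le]
    rw [hsq]
    have : 32 ≤ (4 + σ) ^ 2 / t := by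
      rw [le_div_iff₀ ht]; nlinarith
    linarith
  have hsq2 : Real.sqrt (π / (1 / 2)) ≤ 2.5067 := by
    rw [Real.sqrt_le_left (by norm_num)]
    have := Real.pi_lt_d6
    linarith
  have hisπ : 0.82 / (a * Real.sqrt π) ≤ 0.82 * 0.5643 / a := by
    rw [div_le_div_iff₀ (by positivity) ha]
    have : 1.7724 ≤ Real.sqrt π := by
      rw [Real.le_sqrt (by norm_num) Real.pi_pos.le]
      have := Real.pi_gt_d6; linarith
    nlinarith
  calc 0.82 / (a * Real.sqrt π) *
        ∫ v : ℝ, (Iio v₁).indicator (fun v ↦ Real.exp (-(1 / 2) * (v - 0) ^ 2)) v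
      ≤ 0.82 * 0.5643 / a * (Real.sqrt (π / (1 / 2)) / 2 * Real.exp (-(1 / 2) * (v₁ - 0) ^ 2)) := by
        gcongr
        exact integral_nonneg fun v ↦ indicator_nonneg (fun _ _ ↦ (Real.exp_pos _).le) _
    _ ≤ 0.82 * 0.5643 / a * (2.5067 / 2 * 1.13e-7) := by gcongr
    _ ≤ 1e-7 / a := by
        rw [div_mul_eq_mul_div]
        exact div_le_div_of_nonneg_right (by norm_num) ha.le

end EpsSharp


/-! ## The contour shift (RTN-def with `β_N = πi/4`) in modulus form -/

section Shift

variable {t σ T : ℝ}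

/-- `N + 1/2` is not an integer. [folklore] -/
private theorem int_ne_nat_add_half' (N : ℕ) (n : ℤ) : (n : ℝ) ≠ N + 1 / 2 := by
  intro h
  have h2 : ((2 * n : ℤ) : ℝ) = ((2 * N + 1 : ℤ) : ℝ) := by push_cast; linarith
  have h3 : (2 * n : ℤ) = 2 * N + 1 := by exact_mod_cast h2
  omega

/-- Growth of `w ↦ R_{0,N}(s + √t w)` on the strip `0 ≤ Im w ≤ π√t/8` above the line `Im s = T`:
Gaussian type `< 1`, from the Taylor expansion of `log M₀` (tree: `norm_r0_heat_le`) and the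
strip bound for the Riemann–Siegel line integral. [cite: Polymath2019, Prop. 6.3, proof, first display] -/
theorem exists_norm_R0_strip_le (ht : 0 < t) (ht' : t ≤ 1 / 2) (hT : 100 ≤ T) (N : ℕ) (σ : ℝ) :
    ∃ B : ℝ, ∀ w : ℂ, 0 ≤ w.im → w.im ≤ π * Real.sqrt t / 8 →
      ‖R0 N (((σ : ℂ) + T * I) + Real.sqrt t * w)‖ ≤
        B * Real.exp ((1 / 4 + 1 / (8 * (T - 3.08)) + 1 / 4) * ‖w‖ ^ 2) := by
  obtain ⟨B₂, hB₂, hJ⟩ := exists_norm_rsLineIntegral_strip_le_quarter (c := N + 1 / 2)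
    (by positivity) (int_ne_nat_add_half' N) (T + 1)
  set s : ℂ := (σ : ℂ) + T * I with hs
  refine ⟨Real.exp ((logM₀ s).re + 1 + |σ| * Real.log (1 : ℕ) + (‖alpha s‖ + Real.log (1 : ℕ)) ^ 2) *
    (B₂ * Real.exp (σ ^ 2 / 2)), fun w hw0 hw1 ↦ ?_⟩
  have hst : 0 < Real.sqrt t := Real.sqrt_pos.2 ht
  have hst1 : Real.sqrt t ≤ 1 := (Real.sqrt_le_sqrt (by linarith : t ≤ 1)).trans_eq Real.sqrt_one
  have hπ := Real.pi_lt_d2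
  have him : (s + Real.sqrt t * w).im = T + Real.sqrt t * w.im := by simp [hs]
  have hre : (s + Real.sqrt t * w).re = σ + Real.sqrt t * w.re := by simp [hs]
  -- the `ξ`-prefactor, via `r_{0,1} = xiFactor`
  have h1 : ‖xiFactor (s + Real.sqrt t * w)‖ ≤
      Real.exp ((logM₀ s).re + 1 + |σ| * Real.log (1 : ℕ) + (‖alpha s‖ + Real.log (1 : ℕ)) ^ 2) *
        Real.exp ((1 / 4 + 1 / (8 * (T - 3.08))) * ‖w‖ ^ 2) := by
    have := norm_r0_heat_le (n := 1) ht ht' (by linarith) le_rfl hs (w := w)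
      (by rw [him]; nlinarith [mul_nonneg hst.le hw0])
    simpa [r0] using this
  -- the line integral, on the strip `T ≤ Im ≤ T + 1`
  have h2 : ‖rsLineIntegral (N + 1 / 2) (s + Real.sqrt t * w)‖ ≤
      B₂ * Real.exp (σ ^ 2 / 2) * Real.exp (1 / 4 * ‖w‖ ^ 2) := by
    have hpt : s + Real.sqrt t * w = ((σ + Real.sqrt t * w.re : ℝ) : ℂ) + ((T + Real.sqrt t * w.im : ℝ) : ℂ) * I := by
      apply Complex.ext <;> simp [hs]
    have hτ : |T + Real.sqrt t * w.im| ≤ T + 1 := by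
      rw [abs_of_nonneg (by nlinarith [mul_nonneg hst.le hw0])]
      have : Real.sqrt t * w.im ≤ 1 * (π * 1 / 8) := by
        calc Real.sqrt t * w.im ≤ Real.sqrt t * (π * Real.sqrt t / 8) := by gcongr
          _ ≤ 1 * (π * 1 / 8) := by gcongr
      nlinarith
    rw [hpt]
    refine (hJ _ _ hτ).trans ?_
    rw [mul_assoc, ← Real.exp_add]
    gcongr
    have hre_le : |w.re| ≤ ‖w‖ := Complex.abs_re_le_norm w
    have h3 : (Real.sqrt t * w.re) ^ 2 ≤ 1 / 2 * ‖w‖ ^ 2 := by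
      rw [mul_pow, Real.sq_sqrt ht.le]
      have : w.re ^ 2 ≤ ‖w‖ ^ 2 := by rw [← sq_abs]; gcongr
      nlinarith
    nlinarith [sq_nonneg (σ - Real.sqrt t * w.re)]
  rw [R0, norm_mul]
  have hcast : ((N : ℝ) + 1 / 2 : ℝ) = (N + 1 / 2 : ℝ) := rfl
  calc ‖xiFactor (s + Real.sqrt t * w)‖ * ‖rsLineIntegral (N + 1 / 2) (s + Real.sqrt t * w)‖
      ≤ (Real.exp ((logM₀ s).re + 1 + |σ| * Real.log (1 : ℕ) + (‖alpha s‖ + Real.log (1 : ℕ)) ^ 2) *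
          Real.exp ((1 / 4 + 1 / (8 * (T - 3.08))) * ‖w‖ ^ 2)) *
          (B₂ * Real.exp (σ ^ 2 / 2) * Real.exp (1 / 4 * ‖w‖ ^ 2)) :=
        mul_le_mul h1 h2 (norm_nonneg _) (by positivity)
    _ = _ := by
        rw [show (1 / 4 + 1 / (8 * (T - 3.08)) + 1 / 4) * ‖w‖ ^ 2 =
          (1 / 4 + 1 / (8 * (T - 3.08))) * ‖w‖ ^ 2 + 1 / 4 * ‖w‖ ^ 2 by ring,
          Real.exp_add ((1 / 4 + 1 / (8 * (T - 3.08))) * ‖w‖ ^ 2) (1 / 4 * ‖w‖ ^ 2)]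
        ring

/-- **The shift of the line of integration by `πi√t/8`** (eq. (RTN-def) of the source with
`β_N = πi/4`), in modulus form: for `0 < t ≤ 1/2`, `T ≥ 100` and any `N`,
`|R_{t,N}(σ + iT)| ≤ e^{tπ²/64} ∫ (1/√π) e^{−v²} |R_{0,N}(σ + √t v + iT')| dv`, `T' = T + πt/8`
(the phase `e^{−√t v πi/4}` has modulus one). [cite: Polymath2019, Prop. 6.3, proof, first display] -/
theorem norm_Rt_le_integral (ht : 0 < t) (ht' : t ≤ 1 / 2) (hT : 100 ≤ T) (N : ℕ) (σ : ℝ) :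
    ‖Rt t N ((σ : ℂ) + T * I)‖ ≤ Real.exp (t * π ^ 2 / 64) *
      ∫ v : ℝ, Real.exp (-v ^ 2) / Real.sqrt π *
        ‖R0 N (((σ + Real.sqrt t * v : ℝ) : ℂ) + ((T + π * t / 8 : ℝ) : ℂ) * I)‖ := by
  have hπ0 : 0 < Real.sqrt π := Real.sqrt_pos.2 Real.pi_pos
  have hst : 0 < Real.sqrt t := Real.sqrt_pos.2 ht
  set s : ℂ := (σ : ℂ) + T * I with hs
  set c : ℂ := I * (π * Real.sqrt t / 8 : ℝ) with hc
  have hcim : c.im = π * Real.sqrt t / 8 := by simp [hc]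
  set G : ℂ → ℂ := fun w ↦ R0 N (s + Real.sqrt t * w) / (Real.sqrt π : ℂ) with hG
  -- hypotheses of the Gaussian shift
  obtain ⟨B, hB⟩ := exists_norm_R0_strip_le ht ht' hT N σ
  have hA : (1 / 4 + 1 / (8 * (T - 3.08)) + 1 / 4 : ℝ) < 1 := by
    have : 1 / (8 * (T - 3.08)) ≤ 1 / 8 := by
      rw [div_le_div_iff₀ (by linarith) (by norm_num)]; linarith
    linarith
  have hstrip : ∀ w : ℂ, w.im ∈ uIcc 0 c.im → 0 ≤ w.im ∧ w.im ≤ π * Real.sqrt t / 8 := by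
    intro w hw
    rw [hcim, uIcc_of_le (by positivity)] at hw
    exact hw
  have hd : ∀ w : ℂ, w.im ∈ uIcc 0 c.im → DifferentiableAt ℂ G w := by
    intro w hw
    obtain ⟨hw0, -⟩ := hstrip w hw
    have him : (s + Real.sqrt t * w).im ≠ 0 := by
      have : (s + Real.sqrt t * w).im = T + Real.sqrt t * w.im := by simp [hs]
      rw [this]; nlinarith [mul_nonneg hst.le hw0]
    have h1 : DifferentiableAt ℂ (fun w : ℂ ↦ s + Real.sqrt t * w) w := by fun_prop
    exact ((differentiableAt_R0_of_im_ne_zero N him).comp w h1).div_const _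
  have hg : ∀ w : ℂ, w.im ∈ uIcc 0 c.im →
      ‖G w‖ ≤ B / Real.sqrt π * Real.exp ((1 / 4 + 1 / (8 * (T - 3.08)) + 1 / 4) * ‖w‖ ^ 2) := by
    intro w hw
    obtain ⟨hw0, hw1⟩ := hstrip w hw
    rw [hG]
    simp only [norm_div, Complex.norm_real, Real.norm_of_nonneg hπ0.le]
    rw [div_mul_eq_mul_div]
    exact div_le_div_of_nonneg_right (hB w hw0 hw1) hπ0.le
  have hshift := integral_gaussian_shift hA hd hg
  -- `R_{t,N}(s)` is the shifted integral
  have hRt : Rt t N s = ∫ v : ℝ, G (v + c) * Complex.exp (-((v : ℂ) + c) ^ 2) := by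
    rw [hshift, Rt, heatAvg]
    congr 1; ext v
    rw [hG]
    simp only
    push_cast
    ring
  -- the shifted point and the modulus of the Gaussian
  have hpt : ∀ v : ℝ, s + Real.sqrt t * ((v : ℂ) + c) =
      ((σ + Real.sqrt t * v : ℝ) : ℂ) + ((T + π * t / 8 : ℝ) : ℂ) * I := by
    intro v
    have ht2 : Real.sqrt t * Real.sqrt t = t := Real.mul_self_sqrt ht.le
    apply Complex.ext
    · simp [hs, hc]
    · simp [hs, hc]
      linear_combination (π / 8) * ht2
  have hgauss : ∀ v : ℝ, ‖Complex.exp (-((v : ℂ) + c) ^ 2)‖ = Real.exp (-v ^ 2) * Real.exp (t * π ^ 2 / 64) := by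
    intro v
    rw [Complex.norm_exp, ← Real.exp_add]
    congr 1
    have ht2 : Real.sqrt t * Real.sqrt t = t := Real.mul_self_sqrt ht.le
    simp [hc, sq]
    linear_combination (π ^ 2 / 64) * ht2
  rw [hRt]
  refine (norm_integral_le_integral_norm _).trans (le_of_eq ?_)
  rw [← integral_const_mul]
  congr 1; ext v
  rw [norm_mul, hgauss, hG]
  simp only [norm_div, Complex.norm_real, Real.norm_of_nonneg hπ0.le]
  rw [hpt]
  ring

end Shift


/-! ## Proposition 6.3 with corrected constants -/

section Main

variable {t σ T : ℝ}

/-- The pointwise majorant of `(1/√π)e^{−v²}|R_{0,N}(σ + √t v + iT')|/|M₀(iT')|`: the three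
full-line Gaussian families (`1/2`, `9^u`, `2^{3u/2}`), the `2^{−u}` family restricted to `u < 0`,
and the far tail `u < −4`. [cite: Polymath2019, Prop. 6.3, proof] -/
def rtMajorant (t σ T v : ℝ) : ℝ :=
  Real.exp (-v ^ 2) / Real.sqrt π *
        Real.exp (kapS T * (σ + Real.sqrt t * v) ^ 2 + 0 * (σ + Real.sqrt t * v) + 0.63 / T ^ 2) *
      (1 / 2) +
    Real.exp (-v ^ 2) / Real.sqrt π *
        Real.exp (kapS T * (σ + Real.sqrt t * v) ^ 2 + Real.log 9 * (σ + Real.sqrt t * v) +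
          0.63 / T ^ 2) * (0.1995 / rsA t T) +
    Real.exp (-v ^ 2) / Real.sqrt π *
        Real.exp (kapS T * (σ + Real.sqrt t * v) ^ 2 + 3 / 2 * Real.log 2 * (σ + Real.sqrt t * v) +
          0.63 / T ^ 2) * (0.1729 / rsA t T ^ 2) +
    (Iio (-σ / Real.sqrt t)).indicator (fun v ↦ Real.exp (-v ^ 2) / Real.sqrt π *
        Real.exp (kapS T * (σ + Real.sqrt t * v) ^ 2 + -Real.log 2 * (σ + Real.sqrt t * v) +
          0.63 / T ^ 2)) v *
      (0.1775 / rsA t T + 0.0445 / rsA t T ^ 2 + 0.0176 / rsA t T ^ 3 + 0.07 / rsA t T ^ 4) +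
    (Iio (-(4 + σ) / Real.sqrt t)).indicator
      (fun v ↦ 0.82 / (rsA t T * Real.sqrt π) * Real.exp (-v ^ 2 / 2)) v

/-- `a = rsA t T ≥ 3.98` for `T ≥ 100`, `t ≥ 0`. [cite: Polymath2019, Prop. 6.6 (vi), proof] -/
theorem rsA_ge' (ht : 0 ≤ t) (hT : 100 ≤ T) : 3.98 ≤ rsA t T := by
  have := rsA_ge ht (x := 2 * T) (by linarith)
  rwa [show 2 * T / 2 = T by ring] at this

/-- `√π/(2√2π) ≤ 0.1995` and `1.21/7 ≤ 0.1729`. [folklore] -/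
private theorem consts_pos_regime :
    Real.sqrt π / (2 * (Real.sqrt 2 * π)) ≤ 0.1995 ∧ (1.21 : ℝ) / 7 ≤ 0.1729 := by
  obtain ⟨hc0, hsπ⟩ := c0_le
  refine ⟨?_, by norm_num⟩
  have h0 : 0 ≤ Real.sqrt π := Real.sqrt_nonneg _
  calc Real.sqrt π / (2 * (Real.sqrt 2 * π)) = 1 / (Real.sqrt 2 * π) * Real.sqrt π / 2 := by ring
    _ ≤ 0.22509 * 1.7725 / 2 := by gcongr
    _ ≤ 0.1995 := by norm_num

/-- **The pointwise majorant** of the shifted integrand by `|M₀(iT')| · rtMajorant`: the three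
regimes `u ≥ 0` (`K = 1`), `−4 ≤ u < 0` (`K = 6`), `u < −4` (`K = ⌈−u⌉ + 2`) of Prop. 6.2.
[cite: Polymath2019, Prop. 6.3, proof] -/
theorem pointwise_le_rtMajorant (h : arias_lehmer_rs_bound) (ht : 0 < t) (ht' : t ≤ 1 / 2)
    (hσ : 0 ≤ σ) (hT : 100 ≤ T) (v : ℝ) :
    Real.exp (-v ^ 2) / Real.sqrt π *
        ‖R0 ⌊rsA t T⌋₊ (((σ + Real.sqrt t * v : ℝ) : ℂ) + ((T + π * t / 8 : ℝ) : ℂ) * I)‖ ≤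
      ‖M₀ (I * (T + π * t / 8 : ℝ))‖ * rtMajorant t σ T v := by
  have hπ0 : 0 < Real.sqrt π := Real.sqrt_pos.2 Real.pi_pos
  have hst : 0 < Real.sqrt t := Real.sqrt_pos.2 ht
  have hπ3 := Real.pi_gt_three
  set T' : ℝ := T + π * t / 8 with hT'
  have hT'4 : 4 ≤ T' := by rw [hT']; nlinarith
  set a : ℝ := rsA t T with ha
  have haT : a = Real.sqrt (T' / (2 * π)) := rfl
  have ha1 : 3.98 ≤ a := rsA_ge' ht.le hT
  have ha0 : 0 < a := by linarith
  set u : ℝ := σ + Real.sqrt t * v with hu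
  obtain ⟨hκ0, hκ1, hA, -⟩ := kapS_bounds hT ht.le ht'
  have hq := q_le hT ht.le ht' u
  set κ := kapS T with hκ
  set q₀ : ℝ := 0.63 / T ^ 2 with hq₀
  have hq₀1 : q₀ ≤ 0.0001 := by
    rw [hq₀, div_le_iff₀ (by positivity)]; nlinarith
  set g : ℝ := Real.exp (-v ^ 2) / Real.sqrt π with hg
  have hg0 : 0 < g := by positivity
  set M : ℝ := ‖M₀ (I * (T' : ℂ))‖ with hM
  have hM0 : 0 ≤ M := norm_nonneg _
  have hexpq : Real.exp (u ^ 2 / (4 * (T' - 3)) + (7 / 6 * |u| + 0.33) / T' ^ 2) ≤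
      Real.exp (κ * u ^ 2 + q₀) := Real.exp_le_exp.2 hq
  -- the five terms of the majorant
  set P1 : ℝ := g * Real.exp (κ * u ^ 2 + 0 * u + q₀) * (1 / 2) with hP1
  set P2 : ℝ := g * Real.exp (κ * u ^ 2 + Real.log 9 * u + q₀) * (0.1995 / a) with hP2
  set P3 : ℝ := g * Real.exp (κ * u ^ 2 + 3 / 2 * Real.log 2 * u + q₀) * (0.1729 / a ^ 2) with hP3
  set P4 : ℝ := (Iio (-σ / Real.sqrt t)).indicator (fun v ↦ Real.exp (-v ^ 2) / Real.sqrt π *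
      Real.exp (κ * (σ + Real.sqrt t * v) ^ 2 + -Real.log 2 * (σ + Real.sqrt t * v) + q₀)) v *
    (0.1775 / a + 0.0445 / a ^ 2 + 0.0176 / a ^ 3 + 0.07 / a ^ 4) with hP4
  set P5 : ℝ := (Iio (-(4 + σ) / Real.sqrt t)).indicator
      (fun v ↦ 0.82 / (a * Real.sqrt π) * Real.exp (-v ^ 2 / 2)) v with hP5
  have hmaj : rtMajorant t σ T v = P1 + P2 + P3 + P4 + P5 := rfl
  have hP1n : 0 ≤ P1 := by positivity
  have hP2n : 0 ≤ P2 := by positivity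
  have hP3n : 0 ≤ P3 := by positivity
  have hP4n : 0 ≤ P4 := by
    rw [hP4]
    exact mul_nonneg (indicator_nonneg (fun _ _ ↦ by positivity) _) (by positivity)
  have hP5n : 0 ≤ P5 := by
    rw [hP5]; exact indicator_nonneg (fun _ _ ↦ by positivity) _
  rw [hmaj]
  -- `9^u`, `2^{3u/2}`, `2^{−u}` as exponentials
  have h9 : (9 : ℝ) ^ u = Real.exp (Real.log 9 * u) := Real.rpow_def_of_pos (by norm_num) u
  have h232 : (2 : ℝ) ^ (3 * u / 2) = Real.exp (3 / 2 * Real.log 2 * u) := by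
    rw [Real.rpow_def_of_pos (by norm_num)]; ring_nf
  have h2u : (2 : ℝ) ^ (-u) = Real.exp (-Real.log 2 * u) := by
    rw [Real.rpow_def_of_pos (by norm_num)]; ring_nf
  have hbase : 0 ≤ g * (M * Real.exp (κ * u ^ 2 + q₀)) := by positivity
  rcases le_or_gt 0 u with hu0 | hu0
  · -- regime `u ≥ 0`, `K = 1`
    have hR := norm_R0_line_le h hT'4 (K := 1) le_rfl (Or.inl hu0) (u := u)
    have hW := ariasW_sum_le_pos hu0 (a := a) ha0
    obtain ⟨hc1, hc2⟩ := consts_pos_regime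
    rw [← haT] at hR
    have hW' : ∑ k ∈ Finset.range (1 + 1), ariasW u a k + ariasRS u a 1 ≤
        1 / 2 + 0.1995 * Real.exp (Real.log 9 * u) / a +
          0.1729 * Real.exp (3 / 2 * Real.log 2 * u) / a ^ 2 := by
      refine hW.trans ?_
      rw [← h9, ← h232]
      gcongr
    calc g * ‖R0 ⌊a⌋₊ ((u : ℂ) + (T' : ℂ) * I)‖
        ≤ g * (M * Real.exp (κ * u ^ 2 + q₀) * (1 / 2 + 0.1995 * Real.exp (Real.log 9 * u) / a +
            0.1729 * Real.exp (3 / 2 * Real.log 2 * u) / a ^ 2)) := by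
          refine mul_le_mul_of_nonneg_left (hR.trans ?_) hg0.le
          calc _ ≤ M * Real.exp (u ^ 2 / (4 * (T' - 3)) + (7 / 6 * |u| + 0.33) / T' ^ 2) *
                (1 / 2 + 0.1995 * Real.exp (Real.log 9 * u) / a +
                  0.1729 * Real.exp (3 / 2 * Real.log 2 * u) / a ^ 2) :=
                mul_le_mul_of_nonneg_left hW' (by positivity)
            _ ≤ _ := mul_le_mul_of_nonneg_right (mul_le_mul_of_nonneg_left hexpq hM0) (by positivity)
      _ = M * (P1 + P2 + P3) := by
          rw [hP1, hP2, hP3, zero_mul, add_zero, Real.exp_add _ q₀,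
            Real.exp_add (κ * u ^ 2 + Real.log 9 * u) q₀, Real.exp_add (κ * u ^ 2) (Real.log 9 * u),
            Real.exp_add (κ * u ^ 2 + 3 / 2 * Real.log 2 * u) q₀,
            Real.exp_add (κ * u ^ 2) (3 / 2 * Real.log 2 * u)]
          ring
      _ ≤ M * (P1 + P2 + P3 + P4 + P5) := mul_le_mul_of_nonneg_left (by linarith) hM0
  · rcases le_or_gt (-4) u with hu4 | hu4
    · -- regime `−4 ≤ u < 0`, `K = 6`
      have hR := norm_R0_line_le h hT'4 (K := 6) (by norm_num) (Or.inr (by push_cast; linarith))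
        (u := u)
      have hW := ariasW_sum_le_neg hu0 ha1
      rw [← haT] at hR
      have hv : v ∈ Iio (-σ / Real.sqrt t) := by
        rw [mem_Iio, lt_div_iff₀ hst]; rw [hu] at hu0; linarith
      have hP4v : P4 = g * Real.exp (κ * u ^ 2 + -Real.log 2 * u + q₀) *
          (0.1775 / a + 0.0445 / a ^ 2 + 0.0176 / a ^ 3 + 0.07 / a ^ 4) := by
        rw [hP4, indicator_of_mem hv]
      calc g * ‖R0 ⌊a⌋₊ ((u : ℂ) + (T' : ℂ) * I)‖
          ≤ g * (M * Real.exp (κ * u ^ 2 + q₀) * (1 / 2 + (2 : ℝ) ^ (-u) *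
              (0.1775 / a + 0.0445 / a ^ 2 + 0.0176 / a ^ 3 + 0.07 / a ^ 4))) := by
            refine mul_le_mul_of_nonneg_left (hR.trans ?_) hg0.le
            calc _ ≤ M * Real.exp (u ^ 2 / (4 * (T' - 3)) + (7 / 6 * |u| + 0.33) / T' ^ 2) *
                  (1 / 2 + (2 : ℝ) ^ (-u) *
                    (0.1775 / a + 0.0445 / a ^ 2 + 0.0176 / a ^ 3 + 0.07 / a ^ 4)) :=
                  mul_le_mul_of_nonneg_left hW (by positivity)
              _ ≤ _ := mul_le_mul_of_nonneg_right (mul_le_mul_of_nonneg_left hexpq hM0) (by positivity)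
        _ = M * (P1 + P4) := by
            rw [hP1, hP4v, h2u, zero_mul, add_zero, Real.exp_add _ q₀,
              Real.exp_add (κ * u ^ 2 + -Real.log 2 * u) q₀, Real.exp_add (κ * u ^ 2) (-Real.log 2 * u)]
            ring
        _ ≤ M * (P1 + P2 + P3 + P4 + P5) := mul_le_mul_of_nonneg_left (by linarith) hM0
    · -- far tail `u < −4`, `K = ⌈−u⌉ + 2`
      have hcu : -u ≤ (⌈-u⌉₊ : ℝ) := Nat.le_ceil _
      have hR := norm_R0_line_le h hT'4 (K := ⌈-u⌉₊ + 2) (by omega)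
        (Or.inr (by push_cast; linarith)) (u := u)
      have hW := ariasW_sum_le_far hu4 ha1
      rw [← haT] at hR
      have hv : v ∈ Iio (-(4 + σ) / Real.sqrt t) := by
        rw [mem_Iio, lt_div_iff₀ hst]; rw [hu] at hu4; linarith
      have hP5v : P5 = 0.82 / (a * Real.sqrt π) * Real.exp (-v ^ 2 / 2) := by
        rw [hP5, indicator_of_mem hv]
      have hfar := far_pointwise ht ht' hσ hκ0 hκ1 hq₀1 ha0 (v := v) (by rw [← hu]; exact hu4)
      rw [← hu, ← hg] at hfar
      calc g * ‖R0 ⌊a⌋₊ ((u : ℂ) + (T' : ℂ) * I)‖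
          ≤ g * (M * Real.exp (κ * u ^ 2 + q₀) * (1 / 2 + 0.82 / a * (2 : ℝ) ^ (-u) *
              Real.exp (u ^ 2 / 4 + 3 / 2 * |u| + 2))) := by
            refine mul_le_mul_of_nonneg_left (hR.trans ?_) hg0.le
            calc _ ≤ M * Real.exp (u ^ 2 / (4 * (T' - 3)) + (7 / 6 * |u| + 0.33) / T' ^ 2) *
                  (1 / 2 + 0.82 / a * (2 : ℝ) ^ (-u) * Real.exp (u ^ 2 / 4 + 3 / 2 * |u| + 2)) :=
                  mul_le_mul_of_nonneg_left hW (by positivity)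
              _ ≤ _ := mul_le_mul_of_nonneg_right (mul_le_mul_of_nonneg_left hexpq hM0) (by positivity)
        _ = M * (P1 + g * Real.exp (κ * u ^ 2 + q₀) *
              (0.82 / a * (2 : ℝ) ^ (-u) * Real.exp (u ^ 2 / 4 + 3 / 2 * |u| + 2))) := by
            rw [hP1, zero_mul, add_zero]; ring
        _ ≤ M * (P1 + P5) := by
            rw [hP5v]
            exact mul_le_mul_of_nonneg_left (by linarith) hM0
        _ ≤ M * (P1 + P2 + P3 + P4 + P5) := mul_le_mul_of_nonneg_left (by linarith) hM0


/-- **Integrating the majorant**: `∫ rtMajorant ≤ 1/2 + ε̃♯` (the three full-line Gaussians are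
exact, the `2^{−u}` family by the half-line bound, the far tail by `10⁻⁷/a`).
[cite: Polymath2019, Prop. 6.3, proof] -/
theorem integral_rtMajorant_le (ht : 0 < t) (ht' : t ≤ 1 / 2) (hσ : 0 ≤ σ) (hT : 100 ≤ T) :
    Integrable (rtMajorant t σ T) ∧ ∫ v, rtMajorant t σ T v ≤ 1 / 2 + epsSharp t σ T := by
  obtain ⟨hκ0, hκ1, hA, -⟩ := kapS_bounds hT ht.le ht'
  have ha1 : 3.98 ≤ rsA t T := rsA_ge' ht.le hT
  have ha0 : 0 < rsA t T := by linarith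
  set a := rsA t T with ha
  set κ := kapS T with hκ
  set q₀ : ℝ := 0.63 / T ^ 2 with hq₀
  -- the five pieces
  have I1 := integrable_gauss_family (σ := σ) ht.le (c := 0) (q₀ := q₀) hA
  have I2 := integrable_gauss_family (σ := σ) ht.le (c := Real.log 9) (q₀ := q₀) hA
  have I3 := integrable_gauss_family (σ := σ) ht.le (c := 3 / 2 * Real.log 2) (q₀ := q₀) hA
  have I4 := (integrable_gauss_family (σ := σ) ht.le (c := -Real.log 2) (q₀ := q₀) hA).indicator
    (measurableSet_Iio (a := -σ / Real.sqrt t))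
  have I5 : Integrable fun v : ℝ ↦ (Iio (-(4 + σ) / Real.sqrt t)).indicator
      (fun v ↦ 0.82 / (a * Real.sqrt π) * Real.exp (-v ^ 2 / 2)) v := by
    refine Integrable.indicator ?_ measurableSet_Iio
    have : (fun v : ℝ ↦ 0.82 / (a * Real.sqrt π) * Real.exp (-v ^ 2 / 2)) =
        fun v : ℝ ↦ 0.82 / (a * Real.sqrt π) * Real.exp (-(1 / 2) * v ^ 2) := by
      ext v; congr 2; ring
    rw [this]
    exact (integrable_exp_neg_mul_sq (by norm_num)).const_mul _
  have E1 := integral_gauss_family (σ := σ) ht.le (c := 0) (q₀ := q₀) hA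
  have E2 := integral_gauss_family (σ := σ) ht.le (c := Real.log 9) (q₀ := q₀) hA
  have E3 := integral_gauss_family (σ := σ) ht.le (c := 3 / 2 * Real.log 2) (q₀ := q₀) hA
  have E4 := integral_gauss_half_le (σ := σ) ht (q₀ := q₀) hκ0 hA
  have E5 := far_integral_le ht ht' hσ ha0
  have hInt : Integrable (rtMajorant t σ T) := by
    have := (((I1.mul_const (1 / 2)).add (I2.mul_const (0.1995 / a))).add
      (I3.mul_const (0.1729 / a ^ 2))).add (I4.mul_const
        (0.1775 / a + 0.0445 / a ^ 2 + 0.0176 / a ^ 3 + 0.07 / a ^ 4)) |>.add I5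
    refine this.congr (Eventually.of_forall fun v ↦ ?_)
    simp only [Pi.add_apply, rtMajorant, ← hκ, ← ha, ← hq₀]
  refine ⟨hInt, ?_⟩
  have hsplit : ∫ v, rtMajorant t σ T v =
      (∫ v, Real.exp (-v ^ 2) / Real.sqrt π *
          Real.exp (κ * (σ + Real.sqrt t * v) ^ 2 + 0 * (σ + Real.sqrt t * v) + q₀)) * (1 / 2) +
      (∫ v, Real.exp (-v ^ 2) / Real.sqrt π *
          Real.exp (κ * (σ + Real.sqrt t * v) ^ 2 + Real.log 9 * (σ + Real.sqrt t * v) + q₀)) *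
        (0.1995 / a) +
      (∫ v, Real.exp (-v ^ 2) / Real.sqrt π *
          Real.exp (κ * (σ + Real.sqrt t * v) ^ 2 + 3 / 2 * Real.log 2 * (σ + Real.sqrt t * v) + q₀)) *
        (0.1729 / a ^ 2) +
      (∫ v, (Iio (-σ / Real.sqrt t)).indicator (fun v ↦ Real.exp (-v ^ 2) / Real.sqrt π *
          Real.exp (κ * (σ + Real.sqrt t * v) ^ 2 + -Real.log 2 * (σ + Real.sqrt t * v) + q₀)) v) *
        (0.1775 / a + 0.0445 / a ^ 2 + 0.0176 / a ^ 3 + 0.07 / a ^ 4) +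
      ∫ v, (Iio (-(4 + σ) / Real.sqrt t)).indicator
        (fun v ↦ 0.82 / (a * Real.sqrt π) * Real.exp (-v ^ 2 / 2)) v := by
    unfold rtMajorant
    rw [integral_add, integral_add, integral_add, integral_add, integral_mul_const, integral_mul_const,
      integral_mul_const, integral_mul_const]
    · exact I1.mul_const _
    · exact I2.mul_const _
    · exact (I1.mul_const _).add (I2.mul_const _)
    · exact I3.mul_const _
    · exact ((I1.mul_const _).add (I2.mul_const _)).add (I3.mul_const _)
    · exact I4.mul_const _
    · exact (((I1.mul_const _).add (I2.mul_const _)).add (I3.mul_const _)).add (I4.mul_const _)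
    · exact I5
  rw [hsplit, E1, E2, E3, epsSharp, ← hκ, ← ha, ← hq₀]
  have hP : 0 ≤ 0.1775 / a + 0.0445 / a ^ 2 + 0.0176 / a ^ 3 + 0.07 / a ^ 4 := by positivity
  have h4 := mul_le_mul_of_nonneg_right E4 hP
  refine (add_le_add (add_le_add le_rfl h4) E5).trans (le_of_eq ?_)
  ring

/-- **Polymath 15, Proposition 6.3 (estimate for `R_{t,N}`), with corrected constants.** For
`0 < t ≤ 1/2`, `0 ≤ σ ≤ 1`, `T ≥ 100`, `T' = T + πt/8`, `a = √(T'/2π)`, `N = ⌊a⌋`: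
`|R_{t,N}(σ + iT)| ≤ e^{tπ²/64} |M₀(iT')| (1/2 + ε̃♯(σ + iT))` with `ε̃♯ = epsSharp t σ T`
(the printed statement has `C₀(p) + O_≤(ε̃)`, `|C₀(p)| ≤ 1/2`, with
`ε̃ = (0.397·9^σ/(a−0.865) + 5/(3(T−6))) e^{3.49/(T−4)}`; the constant `0.397 = 0.366 + 0.031`
relies on Prop. 6.2's `σ ≤ 0` bound for `|C_k|`, which carries an extra factor `1/(2π)` relative to
its source, Arias de Reyna 2011, Thm. 4.1 — `0.036` printed for `√2/(2π) = 0.2251` —, so the printed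
`ε̃` does not follow from the cited input; `ε̃♯` is what the printed argument yields from Arias de
Reyna's theorem as vendored in `arias_lehmer_rs_bound`, with the `2^{−u}` family integrated over
`u < 0` only). Conditional on the named fact `arias_lehmer_rs_bound` (Arias de Reyna 2011,
Thms. 3.1, 4.1, 4.2). [cite: Polymath2019, Prop. 6.3] -/
theorem RtN_bound_sharp (h : arias_lehmer_rs_bound) :
    ∀ t σ T : ℝ, 0 < t → t ≤ 1 / 2 → 0 ≤ σ → σ ≤ 1 → 100 ≤ T →
      ‖Rt t ⌊rsA t T⌋₊ ((σ : ℂ) + T * I)‖ ≤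
        Real.exp (t * π ^ 2 / 64) * ‖M₀ (I * (T + π * t / 8 : ℝ))‖ * (1 / 2 + epsSharp t σ T) := by
  intro t σ T ht ht' hσ _hσ1 hT
  have h1 := norm_Rt_le_integral ht ht' hT ⌊rsA t T⌋₊ σ
  obtain ⟨hInt, hI⟩ := integral_rtMajorant_le (σ := σ) ht ht' hσ hT
  have hM0 : 0 ≤ ‖M₀ (I * (T + π * t / 8 : ℝ))‖ := norm_nonneg _
  have h2 : ∫ v : ℝ, Real.exp (-v ^ 2) / Real.sqrt π *
      ‖R0 ⌊rsA t T⌋₊ (((σ + Real.sqrt t * v : ℝ) : ℂ) + ((T + π * t / 8 : ℝ) : ℂ) * I)‖ ≤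
      ‖M₀ (I * (T + π * t / 8 : ℝ))‖ * (1 / 2 + epsSharp t σ T) := by
    calc _ ≤ ∫ v : ℝ, ‖M₀ (I * (T + π * t / 8 : ℝ))‖ * rtMajorant t σ T v :=
          integral_mono_of_nonneg (Eventually.of_forall fun v ↦ by positivity) (hInt.const_mul _)
            (Eventually.of_forall fun v ↦ pointwise_le_rtMajorant h ht ht' hσ hT v)
      _ = ‖M₀ (I * (T + π * t / 8 : ℝ))‖ * ∫ v : ℝ, rtMajorant t σ T v := integral_const_mul _ _
      _ ≤ _ := mul_le_mul_of_nonneg_left hI hM0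
  calc ‖Rt t ⌊rsA t T⌋₊ ((σ : ℂ) + T * I)‖ ≤ _ := h1
    _ ≤ Real.exp (t * π ^ 2 / 64) * (‖M₀ (I * (T + π * t / 8 : ℝ))‖ * (1 / 2 + epsSharp t σ T)) :=
        mul_le_mul_of_nonneg_left h2 (Real.exp_pos _).le
    _ = _ := by ring

end Main

end Polymath15

end Literature.NumberTheory.LFunctions

end
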